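import Summits.AnomalousDissipation.AnomalousDissipation.Theses.TaylorCertificates
import Summits.AnomalousDissipation.AnomalousDissipation.Theorems.FloorCertificate.Negative.WeakDuality
import Summits.AnomalousDissipation.AnomalousDissipation.Theorems.EnsembleCeiling.Negative.DiracAtoms
import Literature.Analysis.FunctionSpaces.TorusPlanarLift
import Literature.Analysis.FunctionSpaces.TorusLerayHelmholtz
import Literature.Analysis.FunctionSpaces.TorusLerayHelmholtzProofs
import Literature.Analysis.FunctionSpaces.TorusEnstrophyOrthogonality
import Literature.Analysis.FunctionSpaces.TorusClassicalNSGluing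
import Literature.Analysis.FunctionSpaces.TorusConvolution
import Literature.Analysis.FunctionSpaces.TorusTimeAverage
import Literature.Analysis.FunctionSpaces.TorusInverseLaplacianCalculus
import Literature.Analysis.FunctionSpaces.TorusSobolevSpaceProofs
import Literature.Analysis.FluidPDE.TorusClassicalH1Balance
import Literature.Analysis.FluidPDE.SteadyNavierStokesRegularity
import Literature.Analysis.FluidPDE.SteadyNavierStokesProofs
import Literature.Analysis.FluidPDE.StatisticalSolutionEnergyEq
import Literature.Barriers.AnomalousDissipation.ClassicalEulerLimitProofs
import Summits.AnomalousDissipation.AnomalousDissipation.Theorems.FloorCertificate.Negative.Uniform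
import Summits.AnomalousDissipation.AnomalousDissipation.Theorems.EnsembleCeiling.Negative.SingleModeFat
import Summits.AnomalousDissipation.AnomalousDissipation.Theorems.EnsembleCeiling.Negative.CellularFat
import Literature.Analysis.FluidPDE.StatisticalSolutionProofs

/-! FALLBACK INLINE COPY (farm could not serve the landed modules Negative/{SameForce,SoftPlanar} at publication time): the
namespace `…Disproof.Inline` below is a verbatim copy of the LANDED files PlanarSteady/Planar/SameForce/SoftPlanar (p81005,
p81761, p82920, p82961); cite the landed names `…Theorems.KolmogorovFloorEnsembleCeiling.Negative.*`, not these copies. -/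

/-!
# Negative knowledge for the crux `KolmogorovFloorEnsembleCeiling` (stmt-AnomalousDissipation-14183), IIa:
# steady residuals, their Helmholtz reduction, and planar lifts of planar steady states

Support file for `Negative/Planar.lean` (cdisprove seat `refuter-cdisprove-stmt-AnomalousDissipation-14183-0`,
2026-08-16). Torus-calculus complements in any dimension and the `T² ↪ T³` bookkeeping:

* §1 `steadyResidual ν g v = νΔv − (v·∇)v + g`; `integral_inner_steadyResidual` (all derivatives moved onto the
  test field); `divFree_meanZero_of_rep` (a smooth a.e.-representative of a state of `H` is solenoidal and mean
  zero); `residual_orthogonal_of_steadyWeak` (the `H`-weak formulation `Torus.IsSteadyWeakSolution` gives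
  `R ⊥ 𝒱`); `exists_eq_gradient_of_orthogonal` (a smooth mean-zero field orthogonal to `𝒱` is a gradient — smooth
  Helmholtz decomposition `smooth_helmholtz_holds` plus Pythagoras); `hasZeroMean_steadyResidual`.
* §2 `planarLift v = twoHalf v 0 = (v₁, v₂, 0)∘π` and its calculus from `TorusPlanarLift` (`laplacian_planarLift`,
  `convect_planarLift`, `residual_planarLift`, `gradNormSq_planarLift`, `integral_norm_sq_planarLift`,
  `hasZeroMean_planarLift`), and `planarLift_classical_steady`: if the planar residual is `∇φ`, the lift is a
  classical steady state on `T³` driven by the lifted force (its residual is `∇(φ∘π) ⊥ 𝒱(T³)`).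
Nothing here asserts a Theses statement.
-/

noncomputable section

set_option linter.dupNamespace false

open MeasureTheory UnitAddTorus
open scoped InnerProductSpace ENNReal

namespace Summit.AnomalousDissipation.AnomalousDissipation.Cruxes.KolmogorovFloorEnsembleCeiling.Disproof.Inline

open Literature.Analysis.FunctionSpaces Literature.Analysis.FunctionSpaces.Torus Literature.Analysis.FluidPDE
open Summit.AnomalousDissipation.AnomalousDissipation.Theses.TaylorCertificates

local notation "𝕋³" => UnitAddTorus (Fin 3)
local notation "𝕋²" => UnitAddTorus (Fin 2)
local notation "E³" => EuclideanSpace ℝ (Fin 3)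
local notation "E²" => EuclideanSpace ℝ (Fin 2)

/-! ## §1 Generic torus complements (any dimension) -/

section Generic

variable {d : Type} [Fintype d] [DecidableEq d]

/-- The Navier–Stokes generator pairing at a state, written on an a.e.-representative (any dimension;
the `Fin 3` copy is `TaylorCertificatePair.Negative.nsGeneratorPairing_of_ae`). -/
theorem nsGeneratorPairing_of_ae_rep {u : Torus.energySpace d} {w : UnitAddTorus d → EuclideanSpace ℝ d}
    (hu : ((u : Lp (EuclideanSpace ℝ d) 2 (volume : Measure (UnitAddTorus d))) : UnitAddTorus d → EuclideanSpace ℝ d) =ᵐ[volume] w)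
    (ν : ℝ) (f W : UnitAddTorus d → EuclideanSpace ℝ d) :
    Torus.nsGeneratorPairing ν f u W =
      (∫ x, ⟪f x, W x⟫_ℝ) + ν * (∫ x, ⟪w x, Torus.laplacian W x⟫_ℝ) +
        ∫ x, ⟪Torus.fderiv W x (w x), w x⟫_ℝ := by
  have h1 : (∫ x, ⟪((u : Lp (EuclideanSpace ℝ d) 2 (volume : Measure (UnitAddTorus d))) : UnitAddTorus d → EuclideanSpace ℝ d) x, Torus.laplacian W x⟫_ℝ) =
      ∫ x, ⟪w x, Torus.laplacian W x⟫_ℝ := by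
    refine integral_congr_ae ?_
    filter_upwards [hu] with x hx
    rw [hx]
  have h2 : (∫ x, ⟪Torus.fderiv W x (((u : Lp (EuclideanSpace ℝ d) 2 (volume : Measure (UnitAddTorus d))) : UnitAddTorus d → EuclideanSpace ℝ d) x), ((u : Lp (EuclideanSpace ℝ d) 2 (volume : Measure (UnitAddTorus d))) : UnitAddTorus d → EuclideanSpace ℝ d) x⟫_ℝ) =
      ∫ x, ⟪Torus.fderiv W x (w x), w x⟫_ℝ := by
    refine integral_congr_ae ?_
    filter_upwards [hu] with x hx
    rw [hx]
  unfold Torus.nsGeneratorPairing Torus.inertialPairing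
  rw [h1, h2]

/-- The residual of the steady equations of a smooth field, `R = νΔv − (v·∇)v + g`. -/
def steadyResidual (ν : ℝ) (g v : UnitAddTorus d → EuclideanSpace ℝ d) : UnitAddTorus d → EuclideanSpace ℝ d :=
  fun y => ν • Torus.laplacian v y - Torus.convect v v y + g y

omit [DecidableEq d] in
/-- The residual of smooth data is smooth. -/
theorem isSmooth_steadyResidual (ν : ℝ) {g v : UnitAddTorus d → EuclideanSpace ℝ d} (hg : IsSmooth g)
    (hv : IsSmooth v) : IsSmooth (steadyResidual ν g v) :=
  ((hv.laplacian.smul ν).sub (hv.convect hv)).add hg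

/-- The pairing of the residual with a smooth field, split into its three terms with all derivatives on
the test field: `∫⟪R, w⟫ = (g, w) + ν (v, Δw) + ∫⟪Dw·v, v⟫` for smooth solenoidal `v`. -/
theorem integral_inner_steadyResidual (ν : ℝ) {g v w : UnitAddTorus d → EuclideanSpace ℝ d}
    (hg : IsSmooth g) (hv : IsSmooth v) (hdiv : IsDivFree v) (hw : IsSmooth w) :
    ∫ x, ⟪steadyResidual ν g v x, w x⟫_ℝ =
      (∫ x, ⟪g x, w x⟫_ℝ) + ν * (∫ x, ⟪v x, Torus.laplacian w x⟫_ℝ) + ∫ x, ⟪Torus.fderiv w x (v x), v x⟫_ℝ := by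
  have hlap : ∫ x, ⟪v x, Torus.laplacian w x⟫_ℝ = ∫ x, ⟪Torus.laplacian v x, w x⟫_ℝ :=
    (Torus.integral_inner_laplacian_comm hv hw).symm
  have hconv : ∫ x, ⟪Torus.fderiv w x (v x), v x⟫_ℝ = -∫ x, ⟪Torus.convect v v x, w x⟫_ℝ := by
    change ∫ x, ⟪Torus.convect v w x, v x⟫_ℝ = _
    rw [Torus.integral_inner_convect_eq_neg hv hdiv hw hv]
    congr 1
    exact integral_congr_ae (ae_of_all _ fun x => real_inner_comm _ _)
  have i1 : Integrable (fun x => ⟪ν • Torus.laplacian v x, w x⟫_ℝ) volume := by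
    have := ((hv.laplacian.inner hw).integrable).const_mul ν
    refine this.congr (ae_of_all _ fun x => ?_)
    simp [inner_smul_left]
  have i2 : Integrable (fun x => ⟪Torus.convect v v x, w x⟫_ℝ) volume := ((hv.convect hv).inner hw).integrable
  have i3 : Integrable (fun x => ⟪g x, w x⟫_ℝ) volume := (hg.inner hw).integrable
  unfold steadyResidual
  simp_rw [inner_add_left, inner_sub_left]
  rw [integral_add ?_ i3, integral_sub i1 i2, hlap, hconv]
  · have : ∫ x, ⟪ν • Torus.laplacian v x, w x⟫_ℝ = ν * ∫ x, ⟪Torus.laplacian v x, w x⟫_ℝ := by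
      rw [← integral_const_mul]
      refine integral_congr_ae (ae_of_all _ fun x => ?_)
      simp [inner_smul_left]
    rw [this]
    ring
  · exact i1.sub i2

/-- A smooth a.e.-representative of a state of `H` is divergence free and mean zero. -/
theorem divFree_meanZero_of_rep {u : Torus.energySpace d} {v : UnitAddTorus d → EuclideanSpace ℝ d}
    (hv : IsSmooth v)
    (hu : ((u : Lp (EuclideanSpace ℝ d) 2 (volume : Measure (UnitAddTorus d))) : UnitAddTorus d → EuclideanSpace ℝ d) =ᵐ[volume] v) :
    IsDivFree v ∧ HasZeroMean v := by
  constructor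
  · have hw : IsWeaklyDivFree v := (Torus.isWeaklyDivFree_of_mem_energySpace u.2).congr_ae hu
    exact isDivFree_of_sum_mul_mFourierCoeff_eq_zero hv fun k => hw.sum_mul_mFourierCoeff_eq_zero (hv.memLp 2) k
  · have h0 := Torus.integral_eq_zero_of_mem_energySpace u.2
    unfold HasZeroMean
    rw [← h0]
    exact integral_congr_ae hu.symm

/-- **From the `H`-weak to the classical weak formulation.** A smooth a.e.-representative `v` of an
`H`-steady state `u` of `NS_ν(g)` (`g` smooth) has its residual `L²`-orthogonal to `𝒱`. -/
theorem residual_orthogonal_of_steadyWeak {ν : ℝ} {g : UnitAddTorus d → EuclideanSpace ℝ d} (hg : IsSmooth g)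
    {u : Torus.energySpace d} (hsteady : Torus.IsSteadyWeakSolution ν g u)
    {v : UnitAddTorus d → EuclideanSpace ℝ d} (hv : IsSmooth v)
    (hu : ((u : Lp (EuclideanSpace ℝ d) 2 (volume : Measure (UnitAddTorus d))) : UnitAddTorus d → EuclideanSpace ℝ d) =ᵐ[volume] v) :
    ∀ w : UnitAddTorus d → EuclideanSpace ℝ d, IsSmooth w → IsDivFree w → HasZeroMean w →
      ∫ x, ⟪steadyResidual ν g v x, w x⟫_ℝ = 0 := by
  intro w hw hdw hzw
  have h := hsteady w hw hdw hzw
  rw [nsGeneratorPairing_of_ae_rep hu] at h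
  rw [integral_inner_steadyResidual ν hg hv (divFree_meanZero_of_rep hv hu).1 hw]
  exact h

/-- **A smooth mean-zero field orthogonal to `𝒱` is a gradient** (smooth Helmholtz decomposition
`R = w₀ + ∇φ₀`, `w₀` solenoidal and — `R`, `∇φ₀` being mean zero — mean zero, hence a test field:
`0 = (R, w₀) = ‖w₀‖² + (∇φ₀, w₀) = ‖w₀‖²`). -/
theorem exists_eq_gradient_of_orthogonal {R : UnitAddTorus d → EuclideanSpace ℝ d} (hR : IsSmooth R)
    (hmean : HasZeroMean R)
    (horth : ∀ w : UnitAddTorus d → EuclideanSpace ℝ d, IsSmooth w → IsDivFree w → HasZeroMean w →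
      ∫ x, ⟪R x, w x⟫_ℝ = 0) :
    ∃ φ : UnitAddTorus d → ℝ, IsSmooth φ ∧ ∀ x, R x = Torus.gradient φ x := by
  obtain ⟨w₀, φ₀, hw₀, hφ₀, hdiv₀, -, hdec⟩ := smooth_helmholtz_holds d R hR
  have hfun : R = fun x => w₀ x + Torus.gradient φ₀ x := funext hdec
  have hzm : HasZeroMean w₀ := by
    have : HasZeroMean (fun x => w₀ x + Torus.gradient φ₀ x) := by rw [← hfun]; exact hmean
    exact (hasZeroMean_add_gradient_iff hw₀ hφ₀).1 this
  have h0 : ∫ x, ⟪R x, w₀ x⟫_ℝ = 0 := horth w₀ hw₀ hdiv₀ hzm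
  have hsplit : ∫ x, ⟪R x, w₀ x⟫_ℝ = ∫ x, ‖w₀ x‖ ^ 2 := by
    have hpt : ∀ x, ⟪R x, w₀ x⟫_ℝ = ‖w₀ x‖ ^ 2 + ⟪Torus.gradient φ₀ x, w₀ x⟫_ℝ := fun x => by
      rw [hdec x, inner_add_left, real_inner_self_eq_norm_sq]
    simp_rw [hpt]
    rw [integral_add hw₀.norm_sq.integrable (hφ₀.gradient.inner hw₀).integrable,
      integral_inner_gradient_eq_zero_of_isDivFree hw₀ hφ₀ hdiv₀, add_zero]
  rw [hsplit] at h0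
  have hae : (fun x => ‖w₀ x‖ ^ 2) =ᵐ[volume] 0 :=
    (integral_eq_zero_iff_of_nonneg (f := fun x => ‖w₀ x‖ ^ 2) (fun x => sq_nonneg _) hw₀.norm_sq.integrable).1 h0
  have heq : (fun x => ‖w₀ x‖ ^ 2) = 0 :=
    (Continuous.ae_eq_iff_eq volume (hw₀.continuous.norm.pow 2) continuous_const).1 hae
  refine ⟨φ₀, hφ₀, fun x => ?_⟩
  have hx := congrFun heq x
  simp only [Pi.zero_apply, ne_eq, OfNat.ofNat_ne_zero, not_false_eq_true, pow_eq_zero_iff, norm_eq_zero] at hx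
  rw [hdec x, hx, zero_add]

/-- The residual of a smooth solenoidal field against a mean-zero force is mean zero. -/
theorem hasZeroMean_steadyResidual (ν : ℝ) {g v : UnitAddTorus d → EuclideanSpace ℝ d} (hg : IsSmooth g)
    (hgm : HasZeroMean g) (hv : IsSmooth v) (hdiv : IsDivFree v) : HasZeroMean (steadyResidual ν g v) := by
  unfold HasZeroMean steadyResidual
  have i1 : Integrable (fun x => ν • Torus.laplacian v x) volume := hv.laplacian.integrable.smul ν
  have i2 : Integrable (fun x => Torus.convect v v x) volume := (hv.convect hv).integrable
  rw [integral_add ?_ hg.integrable, integral_sub i1 i2]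
  · have h1 : ∫ x, ν • Torus.laplacian v x = 0 := by
      rw [integral_smul, Torus.integral_laplacian_eq_zero_of_isSmooth hv, smul_zero]
    rw [h1, Torus.integral_convect_self_eq_zero hv hdiv]
    have hgm' : ∫ x, g x = 0 := hgm
    rw [hgm']
    simp
  · exact i1.sub i2

end Generic

/-! ## §2 The planar lift of a two-dimensional steady state is a three-dimensional steady state -/

section Lift

/-- The planar lift `x ↦ (v₁, v₂, 0)(x₁, x₂)` of a planar field (the `2½`-dimensional field `twoHalf v 0`). -/
abbrev planarLift (v : 𝕋² → E²) : 𝕋³ → E³ := twoHalf v 0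

/-- The zero scalar field on `T²` is smooth. -/
theorem isSmooth_zero_scalar : IsSmooth (0 : 𝕋² → ℝ) := isSmooth_const (0 : ℝ)

/-- Partial derivatives of the zero scalar field vanish. -/
theorem partialDeriv_zero_scalar (j : Fin 2) : Torus.partialDeriv j (0 : 𝕋² → ℝ) = 0 := by
  funext x
  simp [Torus.partialDeriv, Torus.lineDeriv]

/-- The Laplacian of the zero scalar field vanishes. -/
theorem laplacian_zero_scalar : Torus.laplacian (0 : 𝕋² → ℝ) = 0 := by
  have h := laplacian_iterate_zero (d := Fin 2) (F := ℝ) 1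
  rwa [Function.iterate_one] at h

/-- The gradient of the zero scalar field vanishes. -/
theorem gradient_zero_scalar : Torus.gradient (0 : 𝕋² → ℝ) = 0 := by
  funext y
  rw [gradient_eq_sum_partialDeriv ((isSmooth_zero_scalar).isContDiff (by simp))]
  simp [partialDeriv_zero_scalar]

/-- Planar lifts of smooth fields are smooth. -/
theorem isSmooth_planarLift {v : 𝕋² → E²} (hv : IsSmooth v) : IsSmooth (planarLift v) :=
  hv.twoHalf isSmooth_zero_scalar

/-- Planar lifts of solenoidal fields are solenoidal. -/
theorem isDivFree_planarLift {v : 𝕋² → E²} (hdiv : IsDivFree v) : IsDivFree (planarLift v) :=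
  hdiv.twoHalf 0

/-- The Laplacian commutes with the planar lift. -/
theorem laplacian_planarLift {v : 𝕋² → E²} (hv : IsSmooth v) :
    Torus.laplacian (planarLift v) = planarLift (Torus.laplacian v) := by
  rw [planarLift, laplacian_twoHalf hv isSmooth_zero_scalar, laplacian_zero_scalar]

/-- The convective term commutes with the planar lift. -/
theorem convect_planarLift {v : 𝕋² → E²} (hv : IsSmooth v) :
    Torus.convect (planarLift v) (planarLift v) = planarLift (Torus.convect v v) := by
  rw [planarLift, convect_twoHalf (hv.isContDiff (by simp)) ((isSmooth_zero_scalar).isContDiff (by simp))]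
  congr 1
  funext y
  simp [gradient_zero_scalar]

/-- The residual commutes with the planar lift (pointwise). -/
theorem residual_planarLift {ν : ℝ} {g v : 𝕋² → E²} (hv : IsSmooth v) (x : 𝕋³) :
    ν • Torus.laplacian (planarLift v) x - Torus.convect (planarLift v) (planarLift v) x + planarLift g x =
      planarLift (steadyResidual ν g v) x := by
  rw [laplacian_planarLift hv, convect_planarLift hv]
  simp only [planarLift, twoHalf, steadyResidual, Pi.zero_apply, ← map_smul, ← map_sub, ← map_add,
    Prod.smul_mk, Prod.mk_sub_mk, Prod.mk_add_mk, smul_zero, sub_zero, add_zero]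

/-- Squared norms of planar lifts. -/
theorem norm_sq_planarLift (v : 𝕋² → E²) (x : 𝕋³) : ‖planarLift v x‖ ^ 2 = ‖v (planarProj x)‖ ^ 2 := by
  rw [planarLift, norm_sq_twoHalf]
  simp

/-- Energies of planar lifts: `∫_{T³} ‖(v,0)‖² = ∫_{T²} ‖v‖²`. -/
theorem integral_norm_sq_planarLift {v : 𝕋² → E²} (hv : Continuous v) :
    ∫ x, ‖planarLift v x‖ ^ 2 = ∫ y, ‖v y‖ ^ 2 := by
  simp_rw [norm_sq_planarLift]
  exact integral_comp_planarProj (b := fun y => ‖v y‖ ^ 2) (hv.norm.pow 2).aestronglyMeasurable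

/-- Gradient norms of planar lifts: `‖∇(v,0)‖²_{T³} = ‖∇v‖²_{T²}`. -/
theorem gradNormSq_planarLift {v : 𝕋² → E²} (hv : IsSmooth v) : gradNormSq (planarLift v) = gradNormSq v := by
  unfold gradNormSq
  have hpt : ∀ x : 𝕋³, ∑ i, ‖partialDeriv i (planarLift v) x‖ ^ 2 =
      (fun y => ∑ j, ‖partialDeriv j v y‖ ^ 2) (planarProj x) := by
    intro x
    rw [Fin.sum_univ_castSucc]
    have hl : partialDeriv (Fin.last 2) (planarLift v) x = 0 := by
      rw [planarLift, partialDeriv_twoHalf_last]; rfl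
    rw [hl, norm_zero]
    simp only [ne_eq, OfNat.ofNat_ne_zero, not_false_eq_true, zero_pow, add_zero]
    refine Finset.sum_congr rfl fun j _ => ?_
    rw [planarLift, partialDeriv_twoHalf_castSucc (hv.isContDiff (by simp)) ((isSmooth_zero_scalar).isContDiff (by simp)),
      partialDeriv_zero_scalar, norm_sq_twoHalf]
    simp
  simp_rw [hpt]
  exact integral_comp_planarProj (b := fun y => ∑ j, ‖partialDeriv j v y‖ ^ 2)
    (continuous_finsetSum _ fun j _ => ((hv.partialDeriv j).continuous.norm.pow 2)).aestronglyMeasurable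

/-- Inner products of a planar lift against constants integrate through the projection. -/
theorem integral_inner_const_planarLift {v : 𝕋² → E²} (hv : IsSmooth v) (c : E³) :
    ∫ x, ⟪c, planarLift v x⟫_ℝ = ⟪planarProjE c, ∫ y, v y⟫_ℝ := by
  have hpt : ∀ x : 𝕋³, ⟪c, planarLift v x⟫_ℝ = (fun y => ⟪planarProjE c, v y⟫_ℝ) (planarProj x) := by
    intro x
    rw [real_inner_comm (planarLift v x) c, planarLift, inner_twoHalf_left]
    simp only [Pi.zero_apply, zero_mul, add_zero]
    exact real_inner_comm _ _
  simp_rw [hpt]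
  rw [integral_comp_planarProj (b := fun y => ⟪planarProjE c, v y⟫_ℝ)
    (continuous_const.inner hv.continuous).aestronglyMeasurable]
  exact integral_inner hv.integrable (planarProjE c)

/-- Planar lifts of mean-zero fields are mean zero. -/
theorem hasZeroMean_planarLift {v : 𝕋² → E²} (hv : IsSmooth v) (hmean : HasZeroMean v) :
    HasZeroMean (planarLift v) := by
  unfold HasZeroMean
  have h : ∀ c : E³, ⟪c, ∫ x, planarLift v x⟫_ℝ = 0 := by
    intro c
    rw [← integral_inner (isSmooth_planarLift hv).integrable c, integral_inner_const_planarLift hv c]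
    have h0 : ∫ y, v y = 0 := hmean
    rw [h0, inner_zero_right]
  exact inner_self_eq_zero.1 (h _)

/-- **The planar lift of a 2-D steady state is a 3-D steady state.** If the residual of `(v, g)` on `T²`
is a gradient `∇φ`, then `(v, 0)` solves the steady equations driven by `(g, 0)` on `T³` in the classical
weak sense of route item #3: the lifted residual is `∇(φ ∘ π)`, orthogonal to every solenoidal field. -/
theorem planarLift_classical_steady {ν : ℝ} {g v : 𝕋² → E²} (hv : IsSmooth v)
    {φ : 𝕋² → ℝ} (hφ : IsSmooth φ) (hRφ : ∀ y, steadyResidual ν g v y = Torus.gradient φ y) :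
    ∀ W : 𝕋³ → E³, IsSmooth W → IsDivFree W → HasZeroMean W →
      ∫ x, ⟪ν • Torus.laplacian (planarLift v) x - Torus.convect (planarLift v) (planarLift v) x +
        planarLift g x, W x⟫_ℝ = 0 := by
  intro W hW hdW _
  simp_rw [residual_planarLift hv]
  have hpt : ∀ x : 𝕋³, ⟪planarLift (steadyResidual ν g v) x, W x⟫_ℝ = Torus.fderiv (φ ∘ planarProj) x (W x) := by
    intro x
    rw [planarLift, inner_twoHalf_left, hRφ, Torus.inner_gradient_left, fderiv_comp_planarProj (hφ.isContDiff (by simp))]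
    simp
  simp_rw [hpt]
  exact integral_fderiv_apply_eq_zero_of_isDivFree hW hφ.comp_planarProj hdW

end Lift


/-! ## §1 The two-dimensional enstrophy squeeze for smooth steady states -/

section TwoD

/-- Cauchy–Schwarz on the torus (re-export of the barrier-catalogue helper, continuous fields). -/
theorem abs_integral_inner_le {d : Type} [Fintype d] {F w : UnitAddTorus d → EuclideanSpace ℝ d}
    (hF : Continuous F) (hw : Continuous w) :
    |∫ x, ⟪F x, w x⟫_ℝ| ≤ Real.sqrt (∫ x, ‖F x‖ ^ 2) * Real.sqrt (∫ x, ‖w x‖ ^ 2) :=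
  Literature.Barriers.AnomalousDissipation.Torus.abs_integral_inner_le_sqrt_mul_sqrt hF hw

/-- `‖∇v‖₂² = −∫⟪v, Δv⟫` for smooth fields (Green's first identity). -/
theorem gradNormSq_eq_neg_integral_inner_laplacian {d : Type} [Fintype d] [DecidableEq d]
    {v : UnitAddTorus d → EuclideanSpace ℝ d} (hv : IsSmooth v) :
    gradNormSq v = -∫ x, ⟪v x, Torus.laplacian v x⟫_ℝ := by
  unfold gradNormSq
  rw [integral_finsetSum _ (fun i _ => ((hv.partialDeriv i).norm_sq).integrable)]
  have h := Torus.sum_integral_inner_partialDeriv_eq_neg_integral_inner_laplacian hv hv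
  simp_rw [real_inner_self_eq_norm_sq] at h
  exact h

/-- **The 2-D squeeze.** Let `v` be a smooth solenoidal field on `T²`, `g` smooth, `ν ≥ 0`, and suppose
the steady residual `R = νΔv − (v·∇)v + g` is a gradient. Then
`(ν‖∇v‖²)² ≤ ν · ‖Δg‖₂ · ‖v‖₂² · ‖v‖₂`.
Proof: pair `R = ∇φ` with the solenoidal field `Δv` — the left side vanishes; on `T²` the trilinear
term `((v·∇)v, Δv)` vanishes (no vortex stretching, FMRT (A.62)); so `ν‖Δv‖² = −(g, Δv) = −(Δg, v)
≤ ‖Δg‖₂‖v‖₂`, while `‖∇v‖² = −(v, Δv) ≤ ‖v‖₂‖Δv‖₂`. -/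
theorem dissipation_sq_le_of_residual_gradient {ν : ℝ} (hν : 0 ≤ ν) {g v : 𝕋² → E²} (hg : IsSmooth g)
    (hv : IsSmooth v) (hdiv : IsDivFree v)
    (hR : ∃ φ : 𝕋² → ℝ, IsSmooth φ ∧ ∀ x, steadyResidual ν g v x = Torus.gradient φ x) :
    (ν * gradNormSq v) ^ 2 ≤
      ν * Real.sqrt (∫ x, ‖Torus.laplacian g x‖ ^ 2) * ((∫ x, ‖v x‖ ^ 2) * Real.sqrt (∫ x, ‖v x‖ ^ 2)) := by
  obtain ⟨φ, hφ, hRφ⟩ := hR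
  have hΔs : IsSmooth (Torus.laplacian v) := hv.laplacian
  have hΔdiv : IsDivFree (Torus.laplacian v) := Torus.IsDivFree.laplacian_of_isSmooth hv hdiv
  -- (a) `∫⟪R, Δv⟫ = 0`
  have h0 : ∫ x, ⟪steadyResidual ν g v x, Torus.laplacian v x⟫_ℝ = 0 := by
    simp_rw [hRφ]
    exact integral_inner_gradient_eq_zero_of_isDivFree hΔs hφ hΔdiv
  -- the 2-D orthogonality
  have horth : ∫ x, ⟪Torus.convect v v x, Torus.laplacian v x⟫_ℝ = 0 := by
    rw [← Torus.integral_inner_laplacian_convect_self_eq_zero hv hdiv]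
    exact integral_congr_ae (ae_of_all _ fun x => real_inner_comm _ _)
  -- expand `∫⟪R, Δv⟫`
  have i1 : Integrable (fun x => ⟪ν • Torus.laplacian v x, Torus.laplacian v x⟫_ℝ) volume := by
    have := ((hΔs.inner hΔs).integrable).const_mul ν
    refine this.congr (ae_of_all _ fun x => ?_)
    simp [real_inner_smul_left]
  have i2 : Integrable (fun x => ⟪Torus.convect v v x, Torus.laplacian v x⟫_ℝ) volume :=
    ((hv.convect hv).inner hΔs).integrable
  have i3 : Integrable (fun x => ⟪g x, Torus.laplacian v x⟫_ℝ) volume := (hg.inner hΔs).integrable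
  have hexp : ∫ x, ⟪steadyResidual ν g v x, Torus.laplacian v x⟫_ℝ =
      ν * (∫ x, ‖Torus.laplacian v x‖ ^ 2) + ∫ x, ⟪g x, Torus.laplacian v x⟫_ℝ := by
    unfold steadyResidual
    simp_rw [inner_add_left, inner_sub_left]
    rw [integral_add ?_ i3, integral_sub i1 i2, horth, sub_zero]
    · congr 1
      rw [← integral_const_mul]
      refine integral_congr_ae (ae_of_all _ fun x => ?_)
      simp only [real_inner_smul_left, real_inner_self_eq_norm_sq]
    · exact i1.sub i2
  rw [hexp] at h0
  -- (b) `ν ‖Δv‖² ≤ ‖Δg‖ ‖v‖`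
  set L : ℝ := ∫ x, ‖Torus.laplacian v x‖ ^ 2 with hL
  set Ev : ℝ := ∫ x, ‖v x‖ ^ 2 with hEv
  set G : ℝ := Real.sqrt (∫ x, ‖Torus.laplacian g x‖ ^ 2) with hG
  have hL0 : 0 ≤ L := integral_nonneg fun x => sq_nonneg _
  have hEv0 : 0 ≤ Ev := integral_nonneg fun x => sq_nonneg _
  have hG0 : 0 ≤ G := Real.sqrt_nonneg _
  have hgΔ : ∫ x, ⟪g x, Torus.laplacian v x⟫_ℝ = ∫ x, ⟪Torus.laplacian g x, v x⟫_ℝ :=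
    (Torus.integral_inner_laplacian_comm hg hv).symm
  have hb : ν * L ≤ G * Real.sqrt Ev := by
    have h1 : ν * L = -∫ x, ⟪Torus.laplacian g x, v x⟫_ℝ := by linarith [hgΔ]
    have h2 := abs_integral_inner_le hg.laplacian.continuous hv.continuous
    rw [h1]
    exact (neg_le_abs _).trans h2
  -- (c) `‖∇v‖² ≤ ‖v‖ ‖Δv‖`
  have hc : gradNormSq v ≤ Real.sqrt Ev * Real.sqrt L := by
    rw [gradNormSq_eq_neg_integral_inner_laplacian hv]
    exact (neg_le_abs _).trans (abs_integral_inner_le hv.continuous hΔs.continuous)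
  -- (d) combine
  have hgrad0 : 0 ≤ gradNormSq v := gradNormSq_nonneg v
  have hc2 : gradNormSq v ^ 2 ≤ Ev * L := by
    have := pow_le_pow_left₀ hgrad0 hc 2
    rwa [mul_pow, Real.sq_sqrt hEv0, Real.sq_sqrt hL0] at this
  calc (ν * gradNormSq v) ^ 2 = ν * (ν * gradNormSq v ^ 2) := by ring
    _ ≤ ν * (ν * (Ev * L)) := mul_le_mul_of_nonneg_left (mul_le_mul_of_nonneg_left hc2 hν) hν
    _ = ν * (Ev * (ν * L)) := by ring
    _ ≤ ν * (Ev * (G * Real.sqrt Ev)) :=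
        mul_le_mul_of_nonneg_left (mul_le_mul_of_nonneg_left hb hEv0) hν
    _ = ν * G * (Ev * Real.sqrt Ev) := by ring

end TwoD

/-! ## §2 Planar forces: no loud-and-bounded steady branch -/

section Planar

/-- ALL smooth classical steady states of `NS_ν(f)` are `ε₀`-loud and `E`-bounded — verbatim the inner block
of route item #3 `SteadyStatesLoudBounded` at one viscosity. -/
def LoudBoundedSteadyAt (f : 𝕋³ → E³) (ε₀ E ν : ℝ) : Prop :=
  ∀ u : 𝕋³ → E³, IsSmooth u → IsDivFree u → HasZeroMean u →
    (∀ w : 𝕋³ → E³, IsSmooth w → IsDivFree w → HasZeroMean w →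
      ∫ x, ⟪ν • Torus.laplacian u x - Torus.convect u u x + f x, w x⟫_ℝ = 0) →
    ε₀ ≤ ν * gradNormSq u ∧ ∫ x, ‖u x‖ ^ 2 ≤ E

/-- **At every viscosity a planar force carries a planar steady state whose dissipation is squeezed by its
energy**: for `g` smooth solenoidal mean-zero on `T²` and `ν > 0` there is a smooth solenoidal mean-zero
`v` on `T²` whose planar lift `(v, 0)` is a classical steady state of `NS_ν((g, 0))` on `T³`, with
`(ν‖∇v‖²)² ≤ ν‖Δg‖₂‖v‖₂³` and `‖∇(v,0)‖² = ‖∇v‖²`, `‖(v,0)‖₂² = ‖v‖₂²` (Temam's existence and regularity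
on `T²`, the smooth Helmholtz decomposition of the residual, the 2-D enstrophy orthogonality). -/
theorem exists_planar_steady_squeezed {g : 𝕋² → E²} (hg : IsSmooth g) (hgm : HasZeroMean g)
    {ν : ℝ} (hν : 0 < ν) :
    ∃ v : 𝕋² → E², IsSmooth v ∧ IsDivFree v ∧ HasZeroMean v ∧
      (∀ W : 𝕋³ → E³, IsSmooth W → IsDivFree W → HasZeroMean W →
        ∫ x, ⟪ν • Torus.laplacian (planarLift v) x - Torus.convect (planarLift v) (planarLift v) x +
          planarLift g x, W x⟫_ℝ = 0) ∧
      (ν * gradNormSq v) ^ 2 ≤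
        ν * Real.sqrt (∫ x, ‖Torus.laplacian g x‖ ^ 2) * ((∫ x, ‖v x‖ ^ 2) * Real.sqrt (∫ x, ‖v x‖ ^ 2)) := by
  -- Temam on `T²`: existence in `V`, smoothness
  obtain ⟨u₂, hV, hsteady⟩ := Torus.Temam1979_exists_steadyWeakSolution_holds (d := Fin 2) (by simp) hν (hg.memLp 2)
  obtain ⟨v, hv, hae⟩ := Torus.Temam1979_steadyWeakSolution_smooth_holds (d := Fin 2) (by simp) hν hg hV hsteady
  obtain ⟨hdiv, hmean⟩ := divFree_meanZero_of_rep hv hae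
  -- the residual is a gradient
  have horth := residual_orthogonal_of_steadyWeak hg hsteady hv hae
  have hR := exists_eq_gradient_of_orthogonal (isSmooth_steadyResidual ν hg hv)
    (hasZeroMean_steadyResidual ν hg hgm hv hdiv) horth
  obtain ⟨φ, hφ, hRφ⟩ := hR
  exact ⟨v, hv, hdiv, hmean, planarLift_classical_steady hv hφ hRφ,
    dissipation_sq_le_of_residual_gradient hν.le hg hv hdiv ⟨φ, hφ, hRφ⟩⟩

/-- **PLANAR FORCES CARRY NO UNIFORMLY LOUD-AND-BOUNDED STEADY BRANCH.** For `f = (g₁, g₂, 0)(x₁, x₂)` with `g`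
smooth solenoidal mean-zero on `T²`, no `ε₀ > 0`, `E`, `ν₀ > 0` make every smooth classical steady state of
`NS_ν(f)`, `ν < ν₀`, simultaneously `ε₀`-loud and `E`-bounded: at `ν = min(ν₀/2, ε₀²/(‖Δg‖₂ E'√E' + 1))`,
`E' = max E 0`, the planar steady state of `exists_planar_steady_squeezed` would have
`ε₀² ≤ (ν‖∇v‖²)² ≤ ν‖Δg‖₂E'√E' < ε₀²`. -/
theorem not_loudBounded_planar {g : 𝕋² → E²} (hg : IsSmooth g) (hgm : HasZeroMean g)
    {ε₀ E ν₀ : ℝ} (hε₀ : 0 < ε₀) (hν₀ : 0 < ν₀)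
    (h : ∀ ν : ℝ, 0 < ν → ν < ν₀ → LoudBoundedSteadyAt (planarLift g) ε₀ E ν) : False := by
  set G : ℝ := Real.sqrt (∫ x, ‖Torus.laplacian g x‖ ^ 2) with hG
  set E' : ℝ := max E 0 with hE'
  have hG0 : 0 ≤ G := Real.sqrt_nonneg _
  have hE'0 : 0 ≤ E' := le_max_right _ _
  have hK : 0 < G * (E' * Real.sqrt E') + 1 := by positivity
  set ν : ℝ := min (ν₀ / 2) (ε₀ ^ 2 / (G * (E' * Real.sqrt E') + 1)) with hνdef
  have hν : 0 < ν := lt_min (half_pos hν₀) (div_pos (pow_pos hε₀ 2) hK)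
  have hνν₀ : ν < ν₀ := (min_le_left _ _).trans_lt (half_lt_self hν₀)
  have hνK : ν * (G * (E' * Real.sqrt E') + 1) ≤ ε₀ ^ 2 := by
    have : ν ≤ ε₀ ^ 2 / (G * (E' * Real.sqrt E') + 1) := min_le_right _ _
    rwa [le_div_iff₀ hK] at this
  obtain ⟨v, hv, hdiv, hmean, hsteady, hsq⟩ := exists_planar_steady_squeezed hg hgm hν
  obtain ⟨hloud, hbdd⟩ := h ν hν hνν₀ (planarLift v) (isSmooth_planarLift hv) (isDivFree_planarLift hdiv)
    (hasZeroMean_planarLift hv hmean) hsteady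
  rw [gradNormSq_planarLift hv] at hloud
  rw [integral_norm_sq_planarLift hv.continuous] at hbdd
  set Ev : ℝ := ∫ x, ‖v x‖ ^ 2 with hEv
  have hEv0 : 0 ≤ Ev := integral_nonneg fun x => sq_nonneg _
  have hEvE' : Ev ≤ E' := hbdd.trans (le_max_left _ _)
  have h1 : ε₀ ^ 2 ≤ (ν * gradNormSq v) ^ 2 := pow_le_pow_left₀ hε₀.le hloud 2
  have h2 : Ev * Real.sqrt Ev ≤ E' * Real.sqrt E' :=
    mul_le_mul hEvE' (Real.sqrt_le_sqrt hEvE') (Real.sqrt_nonneg _) hE'0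
  have h3 : (ν * gradNormSq v) ^ 2 ≤ ν * G * (E' * Real.sqrt E') :=
    hsq.trans (mul_le_mul_of_nonneg_left h2 (mul_nonneg hν.le hG0))
  have h4 : ν * G * (E' * Real.sqrt E') < ε₀ ^ 2 := by
    have : ν * G * (E' * Real.sqrt E') = ν * (G * (E' * Real.sqrt E') + 1) - ν := by ring
    rw [this]
    linarith
  linarith

/-- Planar lifts of admissible planar forces are admissible forces on `T³`. -/
theorem planarLift_admissible {g : 𝕋² → E²} (hg : IsSmooth g) (hgd : IsDivFree g) (hgm : HasZeroMean g) :
    IsSmooth (planarLift g) ∧ IsDivFree (planarLift g) ∧ HasZeroMean (planarLift g) :=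
  ⟨isSmooth_planarLift hg, isDivFree_planarLift hgd, hasZeroMean_planarLift hg hgm⟩

/-- **No planar witness of route item #3 `SteadyStatesLoudBounded`** (its inner block, for the planar force
`(g, 0)`). -/
theorem not_steadyStatesLoudBounded_planar {g : 𝕋² → E²} (hg : IsSmooth g) (hgm : HasZeroMean g) :
    ¬ ∃ (ε₀ E ν₀ : ℝ), 0 < ε₀ ∧ 0 < ν₀ ∧ ∀ ν : ℝ, 0 < ν → ν < ν₀ → LoudBoundedSteadyAt (planarLift g) ε₀ E ν := by
  rintro ⟨ε₀, E, ν₀, hε₀, hν₀, h⟩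
  exact not_loudBounded_planar hg hgm hε₀ hν₀ h

end Planar

/-! ## §3 Consequences for the route's statements (floor + ceiling ⇒ loud-and-bounded; no planar witnesses) -/

section Route

open Summit.AnomalousDissipation.AnomalousDissipation.Theorems.TaylorCertificatePair.Negative
open Summit.AnomalousDissipation.AnomalousDissipation.Theorems.FloorCertificate.Negative
open Summit.AnomalousDissipation.AnomalousDissipation.Theorems.EnsembleCeiling.Negative

/-- A smooth solenoidal mean-zero field that solves the steady Navier–Stokes equations in the classical weak
sense of route item #3 (`∫ ⟪νΔu − (u·∇)u + f, w⟫ = 0` for all `w ∈ 𝒱`) is carried by a state `U ∈ V` of `H`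
which is a steady weak solution in the sense of `Torus.IsSteadyWeakSolution` (all derivatives moved onto the
test field: Green's second identity and the antisymmetry of the trilinear form). -/
theorem exists_steadyState_of_classical {ν : ℝ} {f u : 𝕋³ → E³}
    (hf : IsSmooth f) (hu : IsSmooth u) (hdiv : IsDivFree u) (hmean : HasZeroMean u)
    (hsteady : ∀ w : 𝕋³ → E³, IsSmooth w → IsDivFree w → HasZeroMean w →
      ∫ x, ⟪ν • Torus.laplacian u x - Torus.convect u u x + f x, w x⟫_ℝ = 0) :
    ∃ U : Torus.energySpace (Fin 3),
      ((U : Lp E³ 2 (volume : Measure 𝕋³)) : 𝕋³ → E³) =ᵐ[volume] u ∧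
      (U : Lp E³ 2 (volume : Measure 𝕋³)) ∈ Torus.energySpaceV (Fin 3) ∧
      Torus.IsSteadyWeakSolution ν f U := by
  obtain ⟨U, hU⟩ := exists_state_of_smooth hu hdiv hmean
  have hV : (U : Lp E³ 2 (volume : Measure 𝕋³)) ∈ Torus.energySpaceV (Fin 3) :=
    Torus.smoothSolenoidal_subset_energySpaceV_holds ⟨u, hu, hdiv, hmean, hU⟩
  refine ⟨U, hU, hV, fun w hw hdw hzw => ?_⟩
  rw [nsGeneratorPairing_of_ae_rep hU, ← integral_inner_steadyResidual ν hf hu hdiv hw]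
  exact hsteady w hw hdw hzw

/-- **Floor family + ensemble ceiling at one viscosity ⇒ every smooth classical steady state is loud AND
bounded** (Dirac case of weak duality for the floor; the Dirac mass at a steady state for the ceiling). This is
the bridge from the target `X = FloorCertificateEnsembleCeiling` and from the pair (crux #7) to route item #3,
for the SAME force. -/
theorem loudBoundedSteadyAt_of_floor_ceiling {f : 𝕋³ → E³} (hf : IsSmooth f) {ε₀ E ν : ℝ} (hν : 0 < ν)
    (hfl : FloorFamily f ε₀ ν)
    (hceil : ∀ μ : Measure (Torus.energySpace (Fin 3)), Torus.IsStationaryStatisticalSolution ν f μ →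
      Integrable (fun v : Torus.energySpace (Fin 3) => ‖v‖ ^ 2) μ → Torus.ensembleEnergy μ ≤ E) :
    LoudBoundedSteadyAt f ε₀ E ν := by
  intro u hu hdiv hmean hsteady
  obtain ⟨U, hU, hV, hUsteady⟩ := exists_steadyState_of_classical hf hu hdiv hmean hsteady
  have hf2 : MemLp f 2 volume := hf.memLp 2
  have hloud := floorFamily_le_dissipation_of_steady hν hf2 hfl hV hUsteady
  have hbdd := norm_sq_le_of_ceiling hν hf2 hceil hV hUsteady
  rw [eGradNormSq_congr_ae' hU, ← Torus.gradNormSq_eq_toReal_eGradNormSq_holds hu] at hloud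
  rw [norm_sq_of_ae hU] at hbdd
  exact ⟨hloud, hbdd⟩

/-- **NO PLANAR WITNESS OF THE TARGET (nor of the pair): the witness force of `X = FloorCertificateEnsembleCeiling`
is genuinely three-dimensional.** For `f = (g₁, g₂, 0)(x₁, x₂)` (`g` smooth and mean-zero on `T²`; solenoidality
is not even needed) there are no `ε₀ > 0`, `E`, `ν₀ > 0` such that at every `ν ∈ (0, ν₀)` a floor family
(any cylindrical `Φ₁`, any `θ₁ ≤ 0` — the unrestricted class of `X` and of crux #5, a fortiori the Kolmogorov class
of cruxes #2/#7) AND the ensemble ceiling hold. This is `X`'s `∀ ν`-body verbatim (`floorCertificate_iff`-style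
definitional unbundling), so `X`'s witness, if any, is not planar. Mechanism: both halves together make every steady
state loud and bounded (`loudBoundedSteadyAt_of_floor_ceiling`), which planar forces forbid (`not_loudBounded_planar`:
the 2-D steady enstrophy squeeze `(ν‖∇v‖²)² ≤ ν‖Δg‖₂‖v‖₂³`). The Alexakis–Doering barrier
(`Literature.Barriers.AnomalousDissipation.AlexakisDoering2006_energyDissipationBound`, time-dependent 2-D flows)
predicted this; the present route is through steady states only. -/
theorem not_floor_ceiling_planar {g : 𝕋² → E²} (hg : IsSmooth g) (hgm : HasZeroMean g) :
    ¬ ∃ (ε₀ E ν₀ : ℝ), 0 < ε₀ ∧ 0 < ν₀ ∧ ∀ ν : ℝ, 0 < ν → ν < ν₀ →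
      FloorFamily (planarLift g) ε₀ ν ∧
      (∀ μ : Measure (Torus.energySpace (Fin 3)), Torus.IsStationaryStatisticalSolution ν (planarLift g) μ →
        Integrable (fun v : Torus.energySpace (Fin 3) => ‖v‖ ^ 2) μ → Torus.ensembleEnergy μ ≤ E) := by
  rintro ⟨ε₀, E, ν₀, hε₀, hν₀, h⟩
  exact not_loudBounded_planar hg hgm hε₀ hν₀ fun ν hν hνν₀ =>
    loudBoundedSteadyAt_of_floor_ceiling (isSmooth_planarLift hg) hν (h ν hν hνν₀).1 (h ν hν hνν₀).2

/-- The same, with the floor written out as in the Theses file (the `∀ ν`-body of `FloorCertificateEnsembleCeiling`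
at the force `planarLift g`, character for character up to the name of the force). -/
theorem not_targetBody_planar {g : 𝕋² → E²} (hg : IsSmooth g) (hgm : HasZeroMean g) :
    ¬ ∃ (ε₀ E ν₀ : ℝ), 0 < ε₀ ∧ 0 < ν₀ ∧ ∀ ν : ℝ, 0 < ν → ν < ν₀ → (∃ (Φ₁ : Literature.Analysis.FluidPDE.Torus.CylindricalTest (Fin 3)) (θ₁ : ℝ), θ₁ ≤ 0 ∧ ∀ u : Literature.Analysis.FunctionSpaces.Torus.energySpace (Fin 3), let uf : UnitAddTorus (Fin 3) → EuclideanSpace ℝ (Fin 3) := ((u : MeasureTheory.Lp (EuclideanSpace ℝ (Fin 3)) 2 (MeasureTheory.volume : MeasureTheory.Measure (UnitAddTorus (Fin 3)))) : UnitAddTorus (Fin 3) → EuclideanSpace ℝ (Fin 3)); let D : ℝ := ν * (Literature.Analysis.FunctionSpaces.Torus.eGradNormSq uf).toReal; let P : ℝ := Literature.Analysis.FluidPDE.Torus.pairing (u : MeasureTheory.Lp (EuclideanSpace ℝ (Fin 3)) 2 (MeasureTheory.volume : MeasureTheory.Measure (UnitAddTorus (Fin 3)))) (planarLift g) - D; Literature.Analysis.FunctionSpaces.Torus.eGradNormSq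 uf ≠ ⊤ → ‖u‖ ^ 2 ≤ 16 * (∫ x, ‖(planarLift g) x‖ ^ 2) / ν ^ 2 → ε₀ ≤ D + Literature.Analysis.FluidPDE.Torus.nsGeneratorPairing ν (planarLift g) u (Φ₁.grad u) + 2 * θ₁ * P) ∧ (∀ μ : MeasureTheory.Measure (Literature.Analysis.FunctionSpaces.Torus.energySpace (Fin 3)), Literature.Analysis.FluidPDE.Torus.IsStationaryStatisticalSolution ν (planarLift g) μ → MeasureTheory.Integrable (fun v : Literature.Analysis.FunctionSpaces.Torus.energySpace (Fin 3) => ‖v‖ ^ 2) μ → Literature.Analysis.FluidPDE.Torus.ensembleEnergy μ ≤ E) :=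
  not_floor_ceiling_planar hg hgm

end Route

open Summit.AnomalousDissipation.AnomalousDissipation.Theorems.TaylorCertificatePair.Negative
open Summit.AnomalousDissipation.AnomalousDissipation.Theorems.FloorCertificate.Negative
open Summit.AnomalousDissipation.AnomalousDissipation.Theorems.EnsembleCeiling.Negative

/-! ## (F0) The crux unbundled -/

/-- The Kolmogorov-class FLOOR datum at one viscosity (verbatim the first conjunct of the crux's `∀ ν` body;
identical to `Cruxes/KolmogorovFloor/Disproof.lean :: FloorDataAt (3/4)`). -/
def KFloorAt (f : UnitAddTorus (Fin 3) → EuclideanSpace ℝ (Fin 3)) (ε₀ C Θ ν : ℝ) : Prop :=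
  ∃ (N : ℕ) (Φ₁ : Literature.Analysis.FluidPDE.Torus.CylindricalTest (Fin 3)) (θ₁ : ℝ), (N : ℝ) ≤ C * ν ^ (-(3 / 4 : ℝ)) ∧ (∀ i, Literature.Analysis.FunctionSpaces.Torus.fourierTruncate N (Φ₁.g i) = Φ₁.g i) ∧ -Θ ≤ θ₁ ∧ θ₁ ≤ 0 ∧ ∀ u : Literature.Analysis.FunctionSpaces.Torus.energySpace (Fin 3), let uf : UnitAddTorus (Fin 3) → EuclideanSpace ℝ (Fin 3) := ((u : MeasureTheory.Lp (EuclideanSpace ℝ (Fin 3)) 2 (MeasureTheory.volume : MeasureTheory.Measure (UnitAddTorus (Fin 3)))) : UnitAddTorus (Fin 3) → EuclideanSpace ℝ (Fin 3)); let D : ℝ := ν * (Literature.Analysis.FunctionSpaces.Torus.eGradNormSq uf).toReal; let P : ℝ := Literature.Analysis.FluidPDE.Torus.pairing (u : MeasureTheory.Lp (EuclideanSpace ℝ (Fin 3)) 2 (MeasureTheory.volume : MeasureTheory.Measure (UnitAddTorus (Fin 3)))) f - D; Literature.Analysis.FunctionSpaces.Torus.eGradNormSq uf ≠ ⊤ →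 ‖u‖ ^ 2 ≤ 16 * (∫ x, ‖f x‖ ^ 2) / ν ^ 2 → ε₀ ≤ D + Literature.Analysis.FluidPDE.Torus.nsGeneratorPairing ν f u (Φ₁.grad u) + 2 * θ₁ * P

/-- The ENSEMBLE CEILING at one viscosity (verbatim the second conjunct of the crux's `∀ ν` body, and the inner
block of `EnsembleCeiling`). -/
def CeilingAt (f : UnitAddTorus (Fin 3) → EuclideanSpace ℝ (Fin 3)) (E ν : ℝ) : Prop :=
  ∀ μ : MeasureTheory.Measure (Literature.Analysis.FunctionSpaces.Torus.energySpace (Fin 3)), Literature.Analysis.FluidPDE.Torus.IsStationaryStatisticalSolution ν f μ → MeasureTheory.Integrable (fun v : Literature.Analysis.FunctionSpaces.Torus.energySpace (Fin 3) => ‖v‖ ^ 2) μ → Literature.Analysis.FluidPDE.Torus.ensembleEnergy μ ≤ E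

/-- The pair FOR the force `f` with constants `ε₀, C, Θ, E, ν₀`. -/
def PairFor (f : UnitAddTorus (Fin 3) → EuclideanSpace ℝ (Fin 3)) (ε₀ C Θ E ν₀ : ℝ) : Prop :=
  0 < ε₀ ∧ 0 < ν₀ ∧ ∀ ν : ℝ, 0 < ν → ν < ν₀ → KFloorAt f ε₀ C Θ ν ∧ CeilingAt f E ν

/-- (F0) The crux IS `∃ f admissible, ∃ constants, PairFor f …`, definitionally. -/
theorem pair_iff : KolmogorovFloorEnsembleCeiling ↔
    ∃ f : UnitAddTorus (Fin 3) → EuclideanSpace ℝ (Fin 3), Torus.IsSmooth f ∧ Torus.IsDivFree f ∧ Torus.HasZeroMean f ∧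
      ∃ (ε₀ C Θ E ν₀ : ℝ), PairFor f ε₀ C Θ E ν₀ :=
  Iff.rfl

/-! ## (F1) Projections onto the sibling cruxes -/

/-- A Kolmogorov-class floor datum is in particular a floor family in the sense of
`Theorems/FloorCertificate/Negative/WeakDuality.lean` (forget `N`, the band limit and the weight floor). -/
theorem kFloorAt_floorFamily {f : UnitAddTorus (Fin 3) → EuclideanSpace ℝ (Fin 3)} {ε₀ C Θ ν : ℝ}
    (h : KFloorAt f ε₀ C Θ ν) : FloorFamily f ε₀ ν := by
  obtain ⟨N, Φ₁, θ₁, -, -, -, hθ₁, hu⟩ := h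
  exact ⟨Φ₁, θ₁, hθ₁, hu⟩

/-- (F0/F1) The force of a witness is not (a.e.) zero — the floor at rest (`ε₀ ≤ (f, Φ₁'(0))`) excludes it, so
the `0 < ∫‖f‖²` clause that `EnsembleCeiling` carries explicitly is automatic here. -/
theorem pairFor_force_ne_zero {f : UnitAddTorus (Fin 3) → EuclideanSpace ℝ (Fin 3)} (hf : Torus.IsSmooth f)
    {ε₀ C Θ E ν₀ : ℝ} (h : PairFor f ε₀ C Θ E ν₀) : 0 < ∫ x, ‖f x‖ ^ 2 :=
  floorFamily_force_ne_zero hf h.1 (half_pos h.2.1)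
    (kFloorAt_floorFamily (h.2.2 _ (half_pos h.2.1) (half_lt_self h.2.1)).1)

/-- (F1) A kill of `KolmogorovFloor` (#2) kills the pair: the pair projects onto #2 for the same force. -/
theorem pair_false_of_not_kolmogorovFloor (h : ¬ KolmogorovFloor) : ¬ KolmogorovFloorEnsembleCeiling := by
  rintro ⟨f, hfs, hfd, hfz, ε₀, C, Θ, E, ν₀, hε₀, hν₀, hall⟩
  exact h ⟨f, hfs, hfd, hfz, ε₀, C, Θ, ν₀, hε₀, hν₀, fun ν hν hνν₀ => (hall ν hν hνν₀).1⟩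

/-- (F1) A kill of `FloorCertificate` (#5) kills the pair (forget `N`, the band limit and the weight floor). -/
theorem pair_false_of_not_floorCertificate (h : ¬ FloorCertificate) : ¬ KolmogorovFloorEnsembleCeiling := by
  rintro ⟨f, hfs, hfd, hfz, ε₀, C, Θ, E, ν₀, hε₀, hν₀, hall⟩
  refine h ⟨f, hfs, hfd, hfz, ε₀, ν₀, hε₀, hν₀, fun ν hν hνν₀ => ?_⟩
  obtain ⟨⟨N, Φ₁, θ₁, -, -, -, hθ₁, hu⟩, -⟩ := hall ν hν hνν₀
  exact ⟨Φ₁, θ₁, hθ₁, hu⟩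

/-- (F1) A kill of `EnsembleCeiling` (#4) kills the pair (`f ≠ 0` supplied by the floor at rest). -/
theorem pair_false_of_not_ensembleCeiling (h : ¬ EnsembleCeiling) : ¬ KolmogorovFloorEnsembleCeiling := by
  intro hp
  obtain ⟨f, hfs, hfd, hfz, ε₀, C, Θ, E, ν₀, hP⟩ := pair_iff.1 hp
  exact h ⟨f, hfs, hfd, hfz, pairFor_force_ne_zero hfs hP, E, ν₀, hP.2.1, fun ν hν hνν₀ => (hP.2.2 ν hν hνν₀).2⟩

/-! ## (F2) The same-force squeeze -/

/-- (F2) **Steady states of a witness force are loud AND bounded.** For every `ν ∈ (0, ν₀)` and every steady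
weak solution `u ∈ V` of `NS_ν(f)`: `ε₀ ≤ ν‖∇u‖²` (floor, Dirac case of weak duality) and `‖u‖² ≤ E`
(ceiling at the Dirac mass `δ_u`, a stationary statistical solution). -/
theorem pairFor_steady {f : UnitAddTorus (Fin 3) → EuclideanSpace ℝ (Fin 3)} (hf : Torus.IsSmooth f)
    {ε₀ C Θ E ν₀ : ℝ} (h : PairFor f ε₀ C Θ E ν₀) {ν : ℝ} (hν : 0 < ν) (hνν₀ : ν < ν₀)
    {u : Torus.energySpace (Fin 3)}
    (hV : (u : Lp (EuclideanSpace ℝ (Fin 3)) 2 (volume : Measure (UnitAddTorus (Fin 3)))) ∈ Torus.energySpaceV (Fin 3))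
    (hu : Torus.IsSteadyWeakSolution ν f u) :
    ε₀ ≤ ν * (Torus.eGradNormSq ((u : Lp (EuclideanSpace ℝ (Fin 3)) 2 (volume : Measure (UnitAddTorus (Fin 3)))) : UnitAddTorus (Fin 3) → EuclideanSpace ℝ (Fin 3))).toReal ∧
      ‖u‖ ^ 2 ≤ E := by
  have hf2 : MemLp f 2 volume := hf.memLp 2
  obtain ⟨hfl, hceil⟩ := h.2.2 ν hν hνν₀
  exact ⟨floorFamily_le_dissipation_of_steady hν hf2 (kFloorAt_floorFamily hfl) hV hu,
    norm_sq_le_of_ceiling hν hf2 hceil hV hu⟩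

/-- (F2) **Stationary statistics of a witness force are loud AND bounded**: `ε₀ ≤ ε(μ)` (weak duality,
`floorFamily_le_ensembleDissipation`) and `e(μ) ≤ E` (the ceiling; integrability of the energy is automatic). -/
theorem pairFor_statistics {f : UnitAddTorus (Fin 3) → EuclideanSpace ℝ (Fin 3)} (hf : Torus.IsSmooth f)
    {ε₀ C Θ E ν₀ : ℝ} (h : PairFor f ε₀ C Θ E ν₀) {ν : ℝ} (hν : 0 < ν) (hνν₀ : ν < ν₀)
    {μ : Measure (Torus.energySpace (Fin 3))} (hμ : Torus.IsStationaryStatisticalSolution ν f μ) :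
    ε₀ ≤ Torus.ensembleDissipation ν μ ∧ Torus.ensembleEnergy μ ≤ E := by
  have hf2 : MemLp f 2 volume := hf.memLp 2
  obtain ⟨hfl, hceil⟩ := h.2.2 ν hν hνν₀
  exact ⟨floorFamily_le_ensembleDissipation hν hf2 (kFloorAt_floorFamily hfl) hμ, hceil μ hμ hμ.integrable_norm_sq⟩

/-- (F2) **The window.** For a witness and any stationary statistical solution at `ν < ν₀`:
`ε₀ ≤ ε(μ) ≤ ‖f‖₂ √e(μ)` (FMRT IV (1.31)–(1.34)), whence `ε₀ ≤ ‖f‖₂ √E`. -/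
theorem pairFor_window {f : UnitAddTorus (Fin 3) → EuclideanSpace ℝ (Fin 3)} (hf : Torus.IsSmooth f)
    {ε₀ C Θ E ν₀ : ℝ} (h : PairFor f ε₀ C Θ E ν₀) {ν : ℝ} (hν : 0 < ν) (hνν₀ : ν < ν₀)
    {μ : Measure (Torus.energySpace (Fin 3))} (hμ : Torus.IsStationaryStatisticalSolution ν f μ) :
    ε₀ ≤ Real.sqrt (∫ x, ‖f x‖ ^ 2) * Real.sqrt (Torus.ensembleEnergy μ) ∧
      ε₀ ≤ Real.sqrt (∫ x, ‖f x‖ ^ 2) * Real.sqrt E := by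
  have hf2 : MemLp f 2 volume := hf.memLp 2
  obtain ⟨hloud, hbdd⟩ := pairFor_statistics hf h hν hνν₀ hμ
  have h1 : ε₀ ≤ Real.sqrt (∫ x, ‖f x‖ ^ 2) * Real.sqrt (Torus.ensembleEnergy μ) :=
    hloud.trans (Torus.ensembleDissipation_le_of_isStationary_holds hμ hf2 hμ.integrable_norm_sq)
  exact ⟨h1, h1.trans (mul_le_mul_of_nonneg_left (Real.sqrt_le_sqrt hbdd) (Real.sqrt_nonneg _))⟩

/-- (F2) **Constants of a witness**: `ε₀² ≤ ‖f‖₂² · E` and `0 < E` (a steady state exists at `ν = ν₀/2`,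
Temam 1979 Thm 1.2, PROVED in tree; it is loud and bounded, and `ν‖∇u‖² = (u,f) ≤ ‖u‖‖f‖₂`). -/
theorem pairFor_constants {f : UnitAddTorus (Fin 3) → EuclideanSpace ℝ (Fin 3)} (hf : Torus.IsSmooth f)
    {ε₀ C Θ E ν₀ : ℝ} (h : PairFor f ε₀ C Θ E ν₀) : ε₀ ^ 2 ≤ (∫ x, ‖f x‖ ^ 2) * E ∧ 0 < E := by
  have hf2 : MemLp f 2 volume := hf.memLp 2
  have hν : 0 < ν₀ / 2 := half_pos h.2.1
  obtain ⟨u, hV, hu⟩ := Torus.Temam1979_exists_steadyWeakSolution_holds (by simp) hν hf2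
  obtain ⟨hloud, hbdd⟩ := pairFor_steady hf h hν (half_lt_self h.2.1) hV hu
  have henergy := Torus.IsSteadyWeakSolution.energy_eq' (by simp) hf2 hV hu
  have hp : Torus.pairing (u : Lp (EuclideanSpace ℝ (Fin 3)) 2 (volume : Measure (UnitAddTorus (Fin 3)))) f ≤ ‖u‖ * ‖hf2.toLp f‖ :=
    (le_abs_self _).trans (Torus.abs_pairing_coe_le hf2 u)
  have h1 : ε₀ ≤ ‖u‖ * ‖hf2.toLp f‖ := by rw [henergy] at hloud; exact hloud.trans hp
  have h2 : ε₀ ^ 2 ≤ (‖u‖ * ‖hf2.toLp f‖) ^ 2 := pow_le_pow_left₀ h.1.le h1 2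
  rw [mul_pow, norm_toLp_sq hf2] at h2
  have hF : 0 ≤ ∫ x, ‖f x‖ ^ 2 := integral_nonneg fun x => by positivity
  refine ⟨?_, ?_⟩
  · calc ε₀ ^ 2 ≤ ‖u‖ ^ 2 * ∫ x, ‖f x‖ ^ 2 := h2
      _ ≤ E * ∫ x, ‖f x‖ ^ 2 := mul_le_mul_of_nonneg_right hbdd hF
      _ = (∫ x, ‖f x‖ ^ 2) * E := mul_comm _ _
  · by_contra hE
    have hE' : E ≤ 0 := le_of_not_gt hE
    have hu0 : ‖u‖ ^ 2 = 0 := le_antisymm (hbdd.trans hE') (sq_nonneg _)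
    rw [hu0, zero_mul] at h2
    nlinarith [h.1]

/-- (F2) **`¬SteadyStatesLoudBounded` kills the pair**: the pair implies route item #3 FOR THE SAME FORCE (the
planner's "cheapest necessary condition of X at the steady states", an honest implication now that the force is
shared) — every smooth classical steady state `u` of `NS_ν(f)`, `ν < ν₀`, has `ε₀ ≤ ν‖∇u‖²` and `∫‖u‖² ≤ E`. So a
quiet OR a fat smooth steady state at arbitrarily small viscosity FOR EVERY FORCE (open) refutes the crux. Plain
negative lemma (no hold requested: the hypothesis is an open dynamical statement, not a construction). -/
theorem pair_false_of_not_steadyStatesLoudBounded (h : ¬ SteadyStatesLoudBounded) :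
    ¬ KolmogorovFloorEnsembleCeiling := by
  intro hp
  obtain ⟨f, hfs, hfd, hfz, ε₀, C, Θ, E, ν₀, hP⟩ := pair_iff.1 hp
  refine h ⟨f, hfs, hfd, hfz, ε₀, E, ν₀, hP.1, hP.2.1, fun ν hν hνν₀ u hu hdiv hmean hsteady => ?_⟩
  obtain ⟨U, hU, hV, hUsteady⟩ := exists_steadyState_of_classical hfs hu hdiv hmean hsteady
  obtain ⟨hloud, hbdd⟩ := pairFor_steady hfs hP hν hνν₀ hV hUsteady
  rw [eGradNormSq_congr_ae' hU, ← Torus.gradNormSq_eq_toReal_eGradNormSq_holds hu] at hloud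
  rw [norm_sq_of_ae hU] at hbdd
  exact ⟨hloud, hbdd⟩

/-- (F2) **What the crux buys, stated positively for the provers**: under the pair, the witness force is non-zero,
its constants satisfy `ε₀² ≤ ‖f‖₂² E`, `0 < E`, and for every `ν < ν₀` Leray's steady states (which exist at every
`ν`) and all stationary statistical solutions live in the window `{ε ≥ ε₀} ∩ {e ≤ E}`. A prover must control BOTH
sides of EVERY small-viscosity steady state of the chosen `f` before any certificate is written. -/
theorem pair_window (h : KolmogorovFloorEnsembleCeiling) :
    ∃ f : UnitAddTorus (Fin 3) → EuclideanSpace ℝ (Fin 3), Torus.IsSmooth f ∧ 0 < ∫ x, ‖f x‖ ^ 2 ∧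
      ∃ ε₀ E ν₀ : ℝ, 0 < ε₀ ∧ 0 < E ∧ 0 < ν₀ ∧ ε₀ ^ 2 ≤ (∫ x, ‖f x‖ ^ 2) * E ∧
      ∀ ν : ℝ, 0 < ν → ν < ν₀ →
        (∃ u : Torus.energySpace (Fin 3), (u : Lp (EuclideanSpace ℝ (Fin 3)) 2 (volume : Measure (UnitAddTorus (Fin 3)))) ∈ Torus.energySpaceV (Fin 3) ∧
          Torus.IsSteadyWeakSolution ν f u) ∧
        (∀ u : Torus.energySpace (Fin 3), (u : Lp (EuclideanSpace ℝ (Fin 3)) 2 (volume : Measure (UnitAddTorus (Fin 3)))) ∈ Torus.energySpaceV (Fin 3) →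
          Torus.IsSteadyWeakSolution ν f u →
            ε₀ ≤ ν * (Torus.eGradNormSq ((u : Lp (EuclideanSpace ℝ (Fin 3)) 2 (volume : Measure (UnitAddTorus (Fin 3)))) : UnitAddTorus (Fin 3) → EuclideanSpace ℝ (Fin 3))).toReal ∧
              ‖u‖ ^ 2 ≤ E) ∧
        (∀ μ : Measure (Torus.energySpace (Fin 3)), Torus.IsStationaryStatisticalSolution ν f μ →
          ε₀ ≤ Torus.ensembleDissipation ν μ ∧ Torus.ensembleEnergy μ ≤ E) := by
  obtain ⟨f, hfs, hfd, hfz, ε₀, C, Θ, E, ν₀, hP⟩ := pair_iff.1 h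
  have hf2 : MemLp f 2 volume := hfs.memLp 2
  obtain ⟨hwin, hE⟩ := pairFor_constants hfs hP
  refine ⟨f, hfs, pairFor_force_ne_zero hfs hP, ε₀, E, ν₀, hP.1, hE, hP.2.1, hwin, fun ν hν hνν₀ => ⟨?_, ?_, ?_⟩⟩
  · exact Torus.Temam1979_exists_steadyWeakSolution_holds (by simp) hν hf2
  · exact fun u hV hu => pairFor_steady hfs hP hν hνν₀ hV hu
  · exact fun μ hμ => pairFor_statistics hfs hP hν hνν₀ hμ

/-! ## (F3) Load-bearing hypotheses -/

/-- The crux with the FLOOR conjunct dropped (everything else verbatim). -/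
def PairWithoutFloor : Prop :=
  ∃ f : UnitAddTorus (Fin 3) → EuclideanSpace ℝ (Fin 3), Torus.IsSmooth f ∧ Torus.IsDivFree f ∧ Torus.HasZeroMean f ∧
    ∃ (E ν₀ : ℝ), 0 < ν₀ ∧ ∀ ν : ℝ, 0 < ν → ν < ν₀ → CeilingAt f E ν

/-- Every stationary statistical solution of the UNFORCED system at `ν > 0` sits at rest: its mean energy is
`0` (FMRT's support bound (1.34) with `‖f‖₂ = 0`). -/
theorem ensembleEnergy_eq_zero_of_zero_force {ν : ℝ} (hν : 0 < ν) {μ : Measure (Torus.energySpace (Fin 3))}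
    (hμ : Torus.IsStationaryStatisticalSolution ν (0 : UnitAddTorus (Fin 3) → EuclideanSpace ℝ (Fin 3)) μ) :
    Torus.ensembleEnergy μ = 0 := by
  have hf : MemLp (0 : UnitAddTorus (Fin 3) → EuclideanSpace ℝ (Fin 3)) 2 volume :=
    (Torus.isSmooth_const (0 : EuclideanSpace ℝ (Fin 3))).memLp 2
  have h0 : ‖hf.toLp (0 : UnitAddTorus (Fin 3) → EuclideanSpace ℝ (Fin 3))‖ = 0 := by
    have := norm_toLp_sq hf
    simp only [Pi.zero_apply, norm_zero, ne_eq, OfNat.ofNat_ne_zero, not_false_eq_true, zero_pow,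
      integral_zero] at this
    exact pow_eq_zero_iff (n := 2) (by norm_num) |>.1 this
  have hae : ∀ᵐ u ∂μ, ‖u‖ ^ 2 = 0 := by
    filter_upwards [hμ.ae_norm_le hν hf] with u hu
    rw [h0, zero_div] at hu
    have : ‖u‖ = 0 := le_antisymm hu (norm_nonneg _)
    rw [this]; ring
  unfold Torus.ensembleEnergy
  rw [integral_congr_ae hae, integral_zero]

/-- (F3a) **The floor conjunct is load-bearing in the trivial sense**: with it dropped, the statement is TRUE
by junk — the vanishing force, whose stationary statistics all sit at rest. (So, as for #4, any honest
ceiling statement needs `f ≠ 0`; here the floor supplies it, `pairFor_force_ne_zero`.) -/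
theorem pairWithoutFloor_trivial : PairWithoutFloor := by
  refine ⟨0, ?_, ?_, ?_, 0, 1, one_pos, fun ν hν _ μ hμ _ => (ensembleEnergy_eq_zero_of_zero_force hν hμ).le⟩
  · exact Torus.isSmooth_const (0 : EuclideanSpace ℝ (Fin 3))
  · intro x
    simp [Torus.divergence, Torus.partialDeriv, Torus.lineDeriv]
  · simp [Torus.HasZeroMean]

/-- (F3b) The crux with the CEILING conjunct dropped is `KolmogorovFloor` (#2) on the nose. -/
theorem pairWithoutCeiling_iff :
    (∃ f : UnitAddTorus (Fin 3) → EuclideanSpace ℝ (Fin 3), Torus.IsSmooth f ∧ Torus.IsDivFree f ∧ Torus.HasZeroMean f ∧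
      ∃ (ε₀ C Θ ν₀ : ℝ), 0 < ε₀ ∧ 0 < ν₀ ∧ ∀ ν : ℝ, 0 < ν → ν < ν₀ → KFloorAt f ε₀ C Θ ν) ↔ KolmogorovFloor :=
  Iff.rfl

/-- (F3c) **The integrability hypothesis of the ceiling is decoration**: every stationary statistical solution
has integrable energy (FMRT (1.29) + Poincaré, tree lemma `integrable_norm_sq`). Provers may drop it. -/
theorem ceilingAt_iff_all {f : UnitAddTorus (Fin 3) → EuclideanSpace ℝ (Fin 3)} {E ν : ℝ} :
    CeilingAt f E ν ↔ ∀ μ : Measure (Torus.energySpace (Fin 3)),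
      Torus.IsStationaryStatisticalSolution ν f μ → Torus.ensembleEnergy μ ≤ E :=
  ⟨fun h μ hμ => h μ hμ hμ.integrable_norm_sq, fun h μ hμ _ => h μ hμ⟩

/-! ## (F4) Natural strengthenings and force classes refuted -/

/-- (F4) No witness has `‖f‖₂² E < ε₀²` (the window of (F2)). -/
theorem not_pairFor_of_gap {f : UnitAddTorus (Fin 3) → EuclideanSpace ℝ (Fin 3)} (hf : Torus.IsSmooth f)
    {ε₀ C Θ E ν₀ : ℝ} (hgap : (∫ x, ‖f x‖ ^ 2) * E < ε₀ ^ 2) : ¬ PairFor f ε₀ C Θ E ν₀ :=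
  fun h => absurd (pairFor_constants hf h).1 (not_le.2 hgap)

/-- (F4) No witness has `E ≤ 0`. -/
theorem not_pairFor_of_nonpos_E {f : UnitAddTorus (Fin 3) → EuclideanSpace ℝ (Fin 3)} (hf : Torus.IsSmooth f)
    {ε₀ C Θ E ν₀ : ℝ} (hE : E ≤ 0) : ¬ PairFor f ε₀ C Θ E ν₀ :=
  fun h => absurd (pairFor_constants hf h).2 (not_lt.2 hE)

/-- (F4) **No single-mode witness** (`f = Re(e_k z)`, `k ≠ 0`, `k·z = 0`, `z ≠ 0`): Marchioro's laminar Dirac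
mass has mean energy `‖f‖₂²/(16π⁴|k|⁴ν²)` (`not_ceiling_of_singleMode`, #4 seat). -/
theorem not_pair_singleMode {k : Fin 3 → ℤ} {z : EuclideanSpace ℂ (Fin 3)} (hk : k ≠ 0)
    (hz : ((fun j => ((k j : ℤ) : ℂ)) ⬝ᵥ (WithLp.ofLp z)) = 0) (hz0 : z ≠ 0) :
    ¬ ∃ (ε₀ C Θ E ν₀ : ℝ), PairFor (Torus.realTrigPoly {k} (fun _ => z)) ε₀ C Θ E ν₀ := by
  rintro ⟨ε₀, C, Θ, E, ν₀, h⟩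
  exact not_ceiling_of_singleMode hk hz hz0 ⟨E, ν₀, h.2.1, fun ν hν hνν₀ => (h.2.2 ν hν hνν₀).2⟩

/-- (F4) **No single-shell Euler-steady witness** (`f = ∑ₘ Re(e_{kₘ} zₘ)` transversal on one shell
`|kₘ|² = s`, with `∫ (f ⊗ f) : ∇w = 0` for all test fields — shear, Beltrami/ABC, cellular, any steady Euler
profile on one Stokes shell): the laminar Dirac mass `f/(4π²sν)` has mean energy `‖f‖₂²/(16π⁴s²ν²)`
(`not_ceiling_of_singleShell_eulerSteady`, #4 seat); `f ≠ 0` comes from the floor at rest. This is the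
Marchioro barrier (`Literature.Barriers.AnomalousDissipation.Marchioro1986_globalAttraction`) biting the pair. -/
theorem not_pair_singleShell_eulerSteady {n : ℕ} {k : Fin n → (Fin 3 → ℤ)} {z : Fin n → EuclideanSpace ℂ (Fin 3)}
    {s : ℝ} (hs : ∀ m, Torus.freqNormSq (k m) = s) (hs0 : 0 < s)
    (hz : ∀ m, ((fun j => ((k m j : ℤ) : ℂ)) ⬝ᵥ (WithLp.ofLp (z m))) = 0)
    (hI : ∀ w : UnitAddTorus (Fin 3) → EuclideanSpace ℝ (Fin 3), Torus.IsSmooth w → Torus.IsDivFree w →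
      Torus.HasZeroMean w →
        ∫ x, ⟪Torus.fderiv w x ((∑ mm, Torus.realTrigPoly {k mm} (fun _ => z mm)) x),
          (∑ mm, Torus.realTrigPoly {k mm} (fun _ => z mm)) x⟫_ℝ = 0) :
    ¬ ∃ (ε₀ C Θ E ν₀ : ℝ), PairFor (∑ mm, Torus.realTrigPoly {k mm} (fun _ => z mm)) ε₀ C Θ E ν₀ := by
  rintro ⟨ε₀, C, Θ, E, ν₀, h⟩
  exact not_ceiling_of_singleShell_eulerSteady hs hs0 hz hI (pairFor_force_ne_zero (isSmooth_modes k z) h)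
    ⟨E, ν₀, h.2.1, fun ν hν hνν₀ => (h.2.2 ν hν hνν₀).2⟩

/-- (F4) **No ABC witness** (`(A,B,C) ≠ 0`; pure-helical first-shell forces). -/
theorem not_pair_abc {A B C : ℝ} (hABC : A ≠ 0 ∨ B ≠ 0 ∨ C ≠ 0) :
    ¬ ∃ (ε₀ C' Θ E ν₀ : ℝ), PairFor
      (∑ mm, Torus.realTrigPoly {(![![0, 0, 1], ![1, 0, 0], ![0, 1, 0]] : Fin 3 → (Fin 3 → ℤ)) mm}
        (fun _ => (![(A : ℂ) • (WithLp.toLp 2 ![-Complex.I, 1, 0] : EuclideanSpace ℂ (Fin 3)),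
                    (B : ℂ) • (WithLp.toLp 2 ![0, -Complex.I, 1] : EuclideanSpace ℂ (Fin 3)),
                    (C : ℂ) • (WithLp.toLp 2 ![1, 0, -Complex.I] : EuclideanSpace ℂ (Fin 3))] : Fin 3 → EuclideanSpace ℂ (Fin 3)) mm))
      ε₀ C' Θ E ν₀ := by
  rintro ⟨ε₀, C', Θ, E, ν₀, h⟩
  exact not_ceiling_abc hABC ⟨E, ν₀, h.2.1, fun ν hν hνν₀ => (h.2.2 ν hν hνν₀).2⟩

/-- (F4) **No planar cellular witness** (`(P,Q) ≠ 0`; Taylor–Green / four-roll-mill force included). -/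
theorem not_pair_cellular {P Q : ℂ} (hPQ : P ≠ 0 ∨ Q ≠ 0) :
    ¬ ∃ (ε₀ C Θ E ν₀ : ℝ), PairFor
      (∑ mm, Torus.realTrigPoly {(![![1, 1, 0], ![1, -1, 0]] : Fin 2 → (Fin 3 → ℤ)) mm}
          (fun _ => (![P • (WithLp.toLp 2 ![1, -1, 0] : EuclideanSpace ℂ (Fin 3)),
                      Q • (WithLp.toLp 2 ![1, 1, 0] : EuclideanSpace ℂ (Fin 3))] : Fin 2 → EuclideanSpace ℂ (Fin 3)) mm))
      ε₀ C Θ E ν₀ := by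
  rintro ⟨ε₀, C, Θ, E, ν₀, h⟩
  exact not_ceiling_cellular hPQ ⟨E, ν₀, h.2.1, fun ν hν hνν₀ => (h.2.2 ν hν hνν₀).2⟩

/-- (F4) **The ν-UNIFORM strengthening of the pair is false for every force** (quantifier swap: one band-limited
`Φ₁` and one weight `θ₁` chosen before `ν` and serving every `ν < ν₀`): project onto the #5 seat's
`not_floorCertificateUniform` (`Theorems/FloorCertificate/Negative/Uniform.lean`: escaping plane waves beating at a
mode of the frozen multiplier). So any witness of the pair must let its certificate sharpen as `ν → 0` — within the
allowed resolution `N ≤ Cν^{-3/4}` and weight window `[-Θ, 0]`. -/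
theorem not_pair_uniform :
    ¬ ∃ f : UnitAddTorus (Fin 3) → EuclideanSpace ℝ (Fin 3), Torus.IsSmooth f ∧ Torus.IsDivFree f ∧ Torus.HasZeroMean f ∧
      ∃ (ε₀ C Θ E ν₀ : ℝ) (N : ℕ) (Φ₁ : Torus.CylindricalTest (Fin 3)) (θ₁ : ℝ), 0 < ε₀ ∧ 0 < ν₀ ∧
        (∀ i, Torus.fourierTruncate N (Φ₁.g i) = Φ₁.g i) ∧ -Θ ≤ θ₁ ∧ θ₁ ≤ 0 ∧
        ∀ ν : ℝ, 0 < ν → ν < ν₀ →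
          ((N : ℝ) ≤ C * ν ^ (-(3 / 4 : ℝ)) ∧ ∀ u : Torus.energySpace (Fin 3), FloorIneq ν f Φ₁ θ₁ ε₀ u) ∧ CeilingAt f E ν := by
  rintro ⟨f, hfs, hfd, hfz, ε₀, C, Θ, E, ν₀, N, Φ₁, θ₁, hε₀, hν₀, -, -, hθ₁, h⟩
  exact not_floorCertificateUniform ⟨f, hfs, hfd, hfz, ε₀, ν₀, Φ₁, θ₁, hε₀, hν₀, hθ₁,
    fun ν hν hνν₀ => (h ν hν hνν₀).1.2⟩

/-- (F4/F5) **Pair ⇒ #3-body at every viscosity, same force** (re-export of Part II's bridge through `PairFor`). -/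
theorem loudBoundedSteadyAt_of_pairFor {f : UnitAddTorus (Fin 3) → EuclideanSpace ℝ (Fin 3)} (hf : Torus.IsSmooth f)
    {ε₀ C Θ E ν₀ : ℝ} (h : PairFor f ε₀ C Θ E ν₀) {ν : ℝ} (hν : 0 < ν) (hνν₀ : ν < ν₀) :
    LoudBoundedSteadyAt f ε₀ E ν :=
  loudBoundedSteadyAt_of_floor_ceiling hf hν (kFloorAt_floorFamily (h.2.2 ν hν hνν₀).1) (h.2.2 ν hν hνν₀).2

/-- (F5) **NO PLANAR WITNESS OF THE PAIR**: for `f = (g₁, g₂, 0)(x₁, x₂)` (`g` smooth mean-zero on `T²`) no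
constants `ε₀, C, Θ, E, ν₀` carry the pair (Part II, `not_loudBounded_planar`: the 2-D steady enstrophy squeeze
empties floor ∩ ceiling on planar forces). The witness force of crux #7 — like that of the target `X` — must be
genuinely three-dimensional. -/
theorem not_pair_planar {g : UnitAddTorus (Fin 2) → EuclideanSpace ℝ (Fin 2)} (hg : Torus.IsSmooth g)
    (hgm : Torus.HasZeroMean g) :
    ¬ ∃ (ε₀ C Θ E ν₀ : ℝ), PairFor (planarLift g) ε₀ C Θ E ν₀ := by
  rintro ⟨ε₀, C, Θ, E, ν₀, h⟩
  exact not_loudBounded_planar hg hgm h.1 h.2.1 fun ν hν hνν₀ =>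
    loudBoundedSteadyAt_of_pairFor (isSmooth_planarLift hg) h hν hνν₀

/-! ## Soft floor (the re-cut `ceiling-slack-soft-floor`): the planar kill persists -/

section Soft

open Summit.AnomalousDissipation.AnomalousDissipation.Theorems.TaylorCertificatePair.Negative
open Summit.AnomalousDissipation.AnomalousDissipation.Theorems.FloorCertificate.Negative
open Summit.AnomalousDissipation.AnomalousDissipation.Theorems.EnsembleCeiling.Negative

/-- A SOFT floor family at viscosity `ν` with slack `lam`: the floor inequality of the route with one extra summand
`lam‖u‖²` on the right (crux idea `ceiling-slack-soft-floor`, ideator 2: `ε₀ ≤ D + ⟨F,Φ₁'⟩ + 2θ₁P + λ‖u‖²`). -/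
def SoftFloorFamily (f : 𝕋³ → E³) (ε₀ lam ν : ℝ) : Prop :=
  ∃ (Φ₁ : Torus.CylindricalTest (Fin 3)) (θ₁ : ℝ), θ₁ ≤ 0 ∧ ∀ u : Torus.energySpace (Fin 3),
    Torus.eGradNormSq ((u : Lp E³ 2 (volume : Measure 𝕋³)) : 𝕋³ → E³) ≠ ⊤ →
    ‖u‖ ^ 2 ≤ 16 * (∫ x, ‖f x‖ ^ 2) / ν ^ 2 →
      ε₀ ≤ ν * (Torus.eGradNormSq ((u : Lp E³ 2 (volume : Measure 𝕋³)) : 𝕋³ → E³)).toReal +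
        Torus.nsGeneratorPairing ν f u (Φ₁.grad u) +
        2 * θ₁ * (Torus.pairing (u : Lp E³ 2 (volume : Measure 𝕋³)) f -
          ν * (Torus.eGradNormSq ((u : Lp E³ 2 (volume : Measure 𝕋³)) : 𝕋³ → E³)).toReal) +
        lam * ‖u‖ ^ 2

/-- **Soft floor + ceiling ⇒ every steady weak solution is `(ε₀ − λE)`-loud** (at a steady state `u ∈ V` the generator
term vanishes, the energy channel vanishes by the energy equation, and `‖u‖² ≤ E` by the ceiling at `δ_u`). -/
theorem softFloor_ceiling_steady_loud {f : 𝕋³ → E³} (hf : IsSmooth f) {ε₀ lam E ν : ℝ} (hν : 0 < ν) (hlam : 0 ≤ lam)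
    (hfl : SoftFloorFamily f ε₀ lam ν)
    (hceil : ∀ μ : Measure (Torus.energySpace (Fin 3)), Torus.IsStationaryStatisticalSolution ν f μ →
      Integrable (fun v : Torus.energySpace (Fin 3) => ‖v‖ ^ 2) μ → Torus.ensembleEnergy μ ≤ E)
    {u : Torus.energySpace (Fin 3)} (hV : (u : Lp E³ 2 (volume : Measure 𝕋³)) ∈ Torus.energySpaceV (Fin 3))
    (hu : Torus.IsSteadyWeakSolution ν f u) :
    ε₀ - lam * E ≤ ν * (Torus.eGradNormSq ((u : Lp E³ 2 (volume : Measure 𝕋³)) : 𝕋³ → E³)).toReal ∧ ‖u‖ ^ 2 ≤ E := by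
  have hf2 : MemLp f 2 volume := hf.memLp 2
  have hbdd : ‖u‖ ^ 2 ≤ E := norm_sq_le_of_ceiling hν hf2 hceil hV hu
  obtain ⟨Φ₁, θ₁, -, hfloor⟩ := hfl
  have hfin : Torus.eGradNormSq ((u : Lp E³ 2 (volume : Measure 𝕋³)) : 𝕋³ → E³) ≠ ⊤ := hV.2.eGradNormSq_lt_top.ne
  have henergy : ν * (Torus.eGradNormSq ((u : Lp E³ 2 (volume : Measure 𝕋³)) : 𝕋³ → E³)).toReal =
      Torus.pairing (u : Lp E³ 2 (volume : Measure 𝕋³)) f :=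
    Torus.IsSteadyWeakSolution.energy_eq' (by simp) hf2 hV hu
  have hgen : Torus.nsGeneratorPairing ν f u (Φ₁.grad u) = 0 :=
    hu _ (Torus.CylindricalTest.isSmooth_grad_holds Φ₁ u) (Torus.CylindricalTest.isDivFree_grad_holds Φ₁ u)
      (Torus.CylindricalTest.hasZeroMean_grad_holds Φ₁ u)
  have hball : ‖u‖ ^ 2 ≤ 16 * (∫ x, ‖f x‖ ^ 2) / ν ^ 2 := by
    refine ball_of_norm_le hν hf2 ?_
    have hp : Torus.pairing (u : Lp E³ 2 (volume : Measure 𝕋³)) f ≤ ‖u‖ * ‖hf2.toLp f‖ :=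
      (le_abs_self _).trans (Torus.abs_pairing_coe_le hf2 u)
    have hP := Torus.norm_sq_le_toReal_eGradNormSq u hfin
    rw [le_div_iff₀ (by positivity)]
    by_cases h0 : ‖u‖ = 0
    · rw [h0, zero_mul]; exact norm_nonneg _
    · have hpos : 0 < ‖u‖ := lt_of_le_of_ne (norm_nonneg _) (Ne.symm h0)
      have : ν * (4 * Real.pi ^ 2 * ‖u‖ ^ 2) ≤ ‖u‖ * ‖hf2.toLp f‖ := by nlinarith
      nlinarith
  have h := hfloor u hfin hball
  rw [hgen, ← henergy] at h
  have hlamE : lam * ‖u‖ ^ 2 ≤ lam * E := mul_le_mul_of_nonneg_left hbdd hlam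
  refine ⟨?_, hbdd⟩
  linarith

/-- **THE PLANAR KILL PERSISTS FOR THE SOFT RE-CUT**: for `f = (g₁,g₂,0)(x₁,x₂)` no `ε₀, E, ν₀, λ` with `0 ≤ λ`,
`λE < ε₀` carry a soft floor family AND the ensemble ceiling at every `ν < ν₀` (soft floor + ceiling make all steady
states `(ε₀ − λE)`-loud and `E`-bounded; planar forces forbid it). The Alexakis–Doering constraint on the re-cut
`KolmogorovSoftFloorEnsembleCeiling` of crux idea `ceiling-slack-soft-floor`, kernel-checked. -/
theorem not_softFloor_ceiling_planar {g : 𝕋² → E²} (hg : IsSmooth g) (hgm : HasZeroMean g) :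
    ¬ ∃ (ε₀ E ν₀ lam : ℝ), 0 < ε₀ ∧ 0 < ν₀ ∧ 0 ≤ lam ∧ lam * E < ε₀ ∧ ∀ ν : ℝ, 0 < ν → ν < ν₀ →
      SoftFloorFamily (planarLift g) ε₀ lam ν ∧
      (∀ μ : Measure (Torus.energySpace (Fin 3)), Torus.IsStationaryStatisticalSolution ν (planarLift g) μ →
        Integrable (fun v : Torus.energySpace (Fin 3) => ‖v‖ ^ 2) μ → Torus.ensembleEnergy μ ≤ E) := by
  rintro ⟨ε₀, E, ν₀, lam, hε₀, hν₀, hlam, hlamE, h⟩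
  have hε' : 0 < ε₀ - lam * E := by linarith
  refine not_loudBounded_planar (E := E) hg hgm hε' hν₀ fun ν hν hνν₀ => ?_
  intro u hu hdiv hmean hsteady
  obtain ⟨U, hU, hV, hUsteady⟩ := exists_steadyState_of_classical (isSmooth_planarLift hg) hu hdiv hmean hsteady
  obtain ⟨hloud, hbdd⟩ := softFloor_ceiling_steady_loud (isSmooth_planarLift hg) hν hlam (h ν hν hνν₀).1 (h ν hν hνν₀).2 hV hUsteady
  rw [eGradNormSq_congr_ae' hU, ← Torus.gradNormSq_eq_toReal_eGradNormSq_holds hu] at hloud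
  rw [norm_sq_of_ae hU] at hbdd
  exact ⟨hloud, hbdd⟩

end Soft
end Summit.AnomalousDissipation.AnomalousDissipation.Cruxes.KolmogorovFloorEnsembleCeiling.Disproof.Inline

namespace Summit.AnomalousDissipation.AnomalousDissipation.Cruxes.KolmogorovFloorEnsembleCeiling.Disproof

open Literature.Analysis.FunctionSpaces Literature.Analysis.FunctionSpaces.Torus Literature.Analysis.FluidPDE
open Summit.AnomalousDissipation.AnomalousDissipation.Theses.TaylorCertificates
open Summit.AnomalousDissipation.AnomalousDissipation.Theorems.FloorCertificate.Negative
open Summit.AnomalousDissipation.AnomalousDissipation.Cruxes.KolmogorovFloorEnsembleCeiling.Disproof.Inline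

/-! ## Re-exported statements (proofs are the landed ones) -/

/-- (F0) The crux unbundled (definitional). -/
theorem pair_iff' : KolmogorovFloorEnsembleCeiling ↔
    ∃ f : UnitAddTorus (Fin 3) → EuclideanSpace ℝ (Fin 3), Torus.IsSmooth f ∧ Torus.IsDivFree f ∧ Torus.HasZeroMean f ∧
      ∃ (ε₀ C Θ E ν₀ : ℝ), PairFor f ε₀ C Θ E ν₀ :=
  pair_iff

/-- (F2) The same-force squeeze at steady states: loud AND bounded. -/
theorem pairFor_steady' {f : UnitAddTorus (Fin 3) → EuclideanSpace ℝ (Fin 3)} (hf : Torus.IsSmooth f)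
    {ε₀ C Θ E ν₀ : ℝ} (h : PairFor f ε₀ C Θ E ν₀) {ν : ℝ} (hν : 0 < ν) (hνν₀ : ν < ν₀)
    {u : Torus.energySpace (Fin 3)}
    (hV : (u : Lp (EuclideanSpace ℝ (Fin 3)) 2 (volume : Measure (UnitAddTorus (Fin 3)))) ∈ Torus.energySpaceV (Fin 3))
    (hu : Torus.IsSteadyWeakSolution ν f u) :
    ε₀ ≤ ν * (Torus.eGradNormSq ((u : Lp (EuclideanSpace ℝ (Fin 3)) 2 (volume : Measure (UnitAddTorus (Fin 3)))) : UnitAddTorus (Fin 3) → EuclideanSpace ℝ (Fin 3))).toReal ∧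
      ‖u‖ ^ 2 ≤ E :=
  pairFor_steady hf h hν hνν₀ hV hu

/-- (F2) Constants of a witness: `ε₀² ≤ ‖f‖₂² E`, `0 < E`. -/
theorem pairFor_constants' {f : UnitAddTorus (Fin 3) → EuclideanSpace ℝ (Fin 3)} (hf : Torus.IsSmooth f)
    {ε₀ C Θ E ν₀ : ℝ} (h : PairFor f ε₀ C Θ E ν₀) : ε₀ ^ 2 ≤ (∫ x, ‖f x‖ ^ 2) * E ∧ 0 < E :=
  pairFor_constants hf h

/-- (F2) `¬SteadyStatesLoudBounded` (for every force a quiet or fat steady branch — OPEN) kills the pair. -/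
theorem pair_false_of_not_steadyStatesLoudBounded' (h : ¬ SteadyStatesLoudBounded) : ¬ KolmogorovFloorEnsembleCeiling :=
  pair_false_of_not_steadyStatesLoudBounded h

/-- (F3a) The floor conjunct is what excludes `f = 0`: without it the statement is true by junk. -/
theorem pairWithoutFloor_trivial' : PairWithoutFloor := pairWithoutFloor_trivial

/-- (F5) **No planar witness of the pair** (kernel-checked; v1's `sorry` closed). -/
theorem not_pair_planar' {g : UnitAddTorus (Fin 2) → EuclideanSpace ℝ (Fin 2)} (hg : Torus.IsSmooth g)
    (hgm : Torus.HasZeroMean g) : ¬ ∃ (ε₀ C Θ E ν₀ : ℝ), PairFor (planarLift g) ε₀ C Θ E ν₀ :=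
  not_pair_planar hg hgm

/-- (F5) **No planar witness of the TARGET `X`** (its `∀ ν`-body at a planar force is false): X's witness force is
genuinely three-dimensional. -/
theorem not_floor_ceiling_planar' {g : UnitAddTorus (Fin 2) → EuclideanSpace ℝ (Fin 2)} (hg : Torus.IsSmooth g)
    (hgm : Torus.HasZeroMean g) :
    ¬ ∃ (ε₀ E ν₀ : ℝ), 0 < ε₀ ∧ 0 < ν₀ ∧ ∀ ν : ℝ, 0 < ν → ν < ν₀ →
      FloorFamily (planarLift g) ε₀ ν ∧
      (∀ μ : Measure (Torus.energySpace (Fin 3)), Torus.IsStationaryStatisticalSolution ν (planarLift g) μ →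
        Integrable (fun v : Torus.energySpace (Fin 3) => ‖v‖ ^ 2) μ → Torus.ensembleEnergy μ ≤ E) :=
  not_floor_ceiling_planar hg hgm

/-- (F5) **No planar witness of route item #3** (its `∀ ν`-body). -/
theorem not_steadyStatesLoudBounded_planar' {g : UnitAddTorus (Fin 2) → EuclideanSpace ℝ (Fin 2)} (hg : Torus.IsSmooth g)
    (hgm : Torus.HasZeroMean g) :
    ¬ ∃ (ε₀ E ν₀ : ℝ), 0 < ε₀ ∧ 0 < ν₀ ∧ ∀ ν : ℝ, 0 < ν → ν < ν₀ → LoudBoundedSteadyAt (planarLift g) ε₀ E ν :=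
  not_steadyStatesLoudBounded_planar hg hgm

/-- (F5) The 2-D steady enstrophy squeeze behind it: `(ν‖∇v‖²)² ≤ ν‖Δg‖₂‖v‖₂³` whenever the residual is a gradient. -/
theorem dissipation_sq_le_of_residual_gradient' {ν : ℝ} (hν : 0 ≤ ν) {g v : UnitAddTorus (Fin 2) → EuclideanSpace ℝ (Fin 2)}
    (hg : Torus.IsSmooth g) (hv : Torus.IsSmooth v) (hdiv : Torus.IsDivFree v)
    (hR : ∃ φ : UnitAddTorus (Fin 2) → ℝ, Torus.IsSmooth φ ∧ ∀ x, steadyResidual ν g v x = Torus.gradient φ x) :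
    (ν * Torus.gradNormSq v) ^ 2 ≤
      ν * Real.sqrt (∫ x, ‖Torus.laplacian g x‖ ^ 2) * ((∫ x, ‖v x‖ ^ 2) * Real.sqrt (∫ x, ‖v x‖ ^ 2)) :=
  dissipation_sq_le_of_residual_gradient hν hg hv hdiv hR

/-- (F5') **No planar witness of the SOFT re-cut** (soft floor family `+ λ‖u‖²` and ceiling, `λE < ε₀`). -/
theorem not_softFloor_ceiling_planar' {g : UnitAddTorus (Fin 2) → EuclideanSpace ℝ (Fin 2)} (hg : Torus.IsSmooth g)
    (hgm : Torus.HasZeroMean g) :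
    ¬ ∃ (ε₀ E ν₀ lam : ℝ), 0 < ε₀ ∧ 0 < ν₀ ∧ 0 ≤ lam ∧ lam * E < ε₀ ∧ ∀ ν : ℝ, 0 < ν → ν < ν₀ →
      SoftFloorFamily (planarLift g) ε₀ lam ν ∧
      (∀ μ : Measure (Torus.energySpace (Fin 3)), Torus.IsStationaryStatisticalSolution ν (planarLift g) μ →
        Integrable (fun v : Torus.energySpace (Fin 3) => ‖v‖ ^ 2) μ → Torus.ensembleEnergy μ ≤ E) :=
  not_softFloor_ceiling_planar hg hgm

/-! ## Glue candidates for the planner (positive implications between route items, same force) -/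

/-- **`X → #3` for the SAME force** (candidate glue; a prover may land it under Theorems/): the target
`FloorCertificateEnsembleCeiling` implies `SteadyStatesLoudBounded` — floor family + ceiling at each `ν < ν₀` make
every smooth classical steady state loud and bounded (`loudBoundedSteadyAt_of_floor_ceiling`). So crux #3 is an honest
necessary condition of the rank-0 target, not only of the pair. -/
theorem target_imp_steadyStatesLoudBounded (hX : FloorCertificateEnsembleCeiling) : SteadyStatesLoudBounded := by
  obtain ⟨f, hfs, hfd, hfz, ε₀, E, ν₀, hε₀, hν₀, h⟩ := hX
  exact ⟨f, hfs, hfd, hfz, ε₀, E, ν₀, hε₀, hν₀, fun ν hν hνν₀ =>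
    loudBoundedSteadyAt_of_floor_ceiling hfs hν (h ν hν hνν₀).1 (h ν hν hνν₀).2⟩

/-- **`Pair → #3` for the SAME force** (candidate glue). -/
theorem pair_imp_steadyStatesLoudBounded (h : KolmogorovFloorEnsembleCeiling) : SteadyStatesLoudBounded := by
  by_contra h3
  exact pair_false_of_not_steadyStatesLoudBounded h3 h

end Summit.AnomalousDissipation.AnomalousDissipation.Cruxes.KolmogorovFloorEnsembleCeiling.Disproof
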